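import Literature.NumberTheory.Sieve.LinearEquationsInPrimesSharpGYEuler
import Literature.NumberTheory.Sieve.LinearEquationsInPrimesSieveDensities
import HarnessLib

/-!
# Linear equations in primes: the Goldston–Yıldırım engine with exponents `a_i = 1`, II–III — the
# main term, local factors of `W`-tricked systems and the correlation estimate
# (Green–Tao 2010, App. D, (D.14)–(D.17), Lemma D.2, Thm. D.3)

Trunk T-SIEVE (`Literature/NumberTheory/Sieve`), ninth file of the programme decomposing the named
fact `Literature.NumberTheory.Sieve.GreenTao2010_gowersUniformity` (B. Green, T. Tao, *Linear
equations in primes*, Ann. of Math. 171 (2010), Thm. 7.2) inline. The previous file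
(`…SharpGYEuler.lean`, Part I) expressed the `χ`-weighted square-free tuple sums
`∑ (∏_p α(p, X_p(e))) ∏_i μ(e_i)χ(log e_i/log R)` of the `a_i = 1` Goldston–Yıldırım engine, for
abstract local factors `α(p, B)` (`SharpGY.LocalCoeff`), as `∫ (∏_i φ(η_i)) L(η) dη` with
`L(η) = (∏_i ζ(1+z_i)^{-1}/∏_{p≤w} E'_p) ∏'_q (1 + δ'_q)`, `z_i = z(η_i) = (1 - 2πiη_i)/log R`
(the tree's CFZ Fourier normalisation `CFZ.zOf`; the paper writes `(1 + iξ)/log R`).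

**Part II (main term)** evaluates that integral (the paper's (D.14)–(D.17), with the sieve factor
of Lemma D.2 for `a = 1`):

* one variable: `SharpGY.mainFactor R w x = (log R) ζ(1+z(x))^{-1} (φ(W)/W)/∏_{p≤w}(1 - p^{-1-z(x)})`,
  with `norm_mainFactor_sub_aF_le` (`F̃(x) = a(x)(1 + O(|z|(1 + ∑_{p≤w} log p/p)))` for small `z`,
  from `zζ(1+z) = 1 + O(|z|)` and the small-prime ratio `norm_smallRatio_sub_one_le`),
  `norm_mainFactor_le_crude` (`‖F̃‖ ≤ log R (log R + C)` from the Euler-product bound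
  `exists_norm_inv_zeta_le`), `integral_phiF_mul_aF` (`∫ φ a = -χ'(0) = c_{χ,1}`, Lemma D.2), and
  `exists_mainFactor_integral_bound`
  (`∫ φ F̃ = -χ'(0) + O((1 + S₁(w)) log^{-1/2} R)`, `∫ |φ F̃| = O(1)`, splitting at `|x| = log^{1/2} R`
  and using the decay of `φ` in the tail);
* `|ι|` variables: `logpow_mul_main_eq`
  (`log^{|ι|} R (∏_i ζ(1+z_i)^{-1})/∏_{p≤w} E'_p = (W/φ(W))^{|ι|} ∏_i F̃(η_i)`), `SharpGY.limitFn`,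
  its measurability, and the main result `exists_main_term_bound`:
  `‖log^{|ι|} R ∫ (∏_i φ(η_i)) L(η) dη - (W/φ(W))^{|ι|} c^{|ι|}‖ ≤ (W/φ(W))^{|ι|} K ((1 + S₁(w)) log^{-1/2} R + (e^{4·2^{|ι|}/w} - 1))`
  — i.e. Thm. D.3 (D.9) with `a_i = 1` for the `W`-tricked systems: sieve factors `c_{χ,1}^{|ι|}`,
  local factors `∏_{p≤w} β_p = (W/φ(W))^{|ι|}` and `∏_{p>w} β_p = 1 + O(1/w)` (p. 1834).

**Part III (arithmetic side)** supplies the rest of the proof of Thm. D.3 (App. D, pp. 1830–1831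
and p. 1834) for the systems relevant to (12.6):

* `SharpGY.wtrickSys W L b` — the `W`-tricked system `ψ_i(n) = W(L_i · n) + b` (all forms in one
  residue class `b (mod W)`, `gcd(b, W) = 1`), `SharpGY.GoodSystem L` (every `L_i` has an entry `1`,
  every pair a unimodular `2×2` minor: no exceptional primes), and `SharpGY.wtrickCoeff` — its local
  factors `α(p, B) = primeDensity` **satisfy the `LocalCoeff` hypotheses** (`α(p,B) = 0` for `p ∣ W`,
  `B ≠ ∅`; `= 1/p` for `B = {i}`, `≤ 1/p²` for `|B| ≥ 2` when `p ∤ W`; from the tree's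
  `primeDensity_singleton`, `primeDensity_le_of_minor` and `primeDensity_eq_zero_of_const` here);
* the Chinese-remainder/volume-packing count `exists_sum_dvd_indicator_bound`:
  `∑_{n ∈ K ∩ ℤ^d} ∏_i 1_{e_i ∣ ψ_i(n)} = vol(K) ∏_p α(p, X_p(e)) + O_d(E (N + 2E)^{d-1})` for square-free
  tuples (the tree's `sum_periodic_weight` with the radical of `∏ e_i` as modulus, and
  `CFZ.expect_prod_crt`);
* the `a_i = 1` expansion `sum_prod_truncDivisorSum_one_eq`, the re-indexing of the coefficient sum by
  square-free tuples `sum_box_eq_sum_squarefree(_of)` (`μ` kills non-square-free entries, `supp χ` the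
  entries `≥ R`), the summed error `sum_box_error_le`;
* `exists_main_term_bound_uniform` — the main-term bound of Part II with the constants
  quantified before the local data (they depend on `χ` and the number of forms only; the previous
  file's statement fixes the local factors first, which would not give the uniformity in `w` and `b`
  required by (12.6); the proof is repeated with this quantifier order);
* the main result `exists_wtrick_correlation_bound` — **Thm. D.3 with `a_i = 1` for `W`-tricked good
  systems over convex bodies**:
  `|∑_{n ∈ A ∩ ℤ^d} ∏_i Λ_{χ,R,1}(W(L_i·n) + b) - vol(A)(W/φ(W))^t (-χ'(0))^t| ≤ vol(A)(W/φ(W))^t K ((1 + S₁(w)) log^{-1/2} R + e^{4·2^t/w} - 1) + C log^t R · R^{2t}(N + 2R^t)^{d-1}`,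
  constants depending on `χ, t, d` only.

All statements are theorems; constants are explicit; no named facts are introduced. The engine is
consumed by `LinearEquationsInPrimesSharpUniform.lean` ((12.6): `SharpGY.sharpUniformAt_of_cutoff`,
and the final assemblies of Thm. 7.2 relative to the smoothly metrised class of
`LinearEquationsInPrimesMetricClass.lean`). (Parts II and III were written as two modules; they are
one file because the library build never produced a compiled artifact for the separate Part II
module `LinearEquationsInPrimesSharpGYMainTerm`, now an empty placeholder.)

## References

* B. Green, T. Tao, *Linear equations in primes*, Ann. of Math. (2) 171 (2010), 1753–1850
  (arXiv:math/0606088), App. D: Def. D.1, Lemma D.2, Thm. D.3 and its proof (pp. 1829–1834),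
  (D.9'), (D.13)–(D.17), Lemma D.5; §12, (12.6).
* D. Conlon, J. Fox, Y. Zhao, *The Green–Tao theorem: an exposition*, EMS Surv. Math. Sci. 1
  (2014), §9 (Fourier normalisation, zeta and Chinese-remainder lemmas of the tree's
  `SmoothMajorant*` files).
-/

/-! ## Part II — the main term ((D.14)–(D.17), Lemma D.2 for `a = 1`) -/

noncomputable section

open Finset Complex Filter Topology MeasureTheory
open scoped BigOperators

namespace Literature.NumberTheory.Sieve.SharpGY

open Literature.NumberTheory.Sieve.CFZ

/-! ### Elementary complex estimates -/

/-- `e^x - 1 ≤ 2x` for `0 ≤ x ≤ 1` (as `e^x ≤ 1 + x + x²` there). (The same statement is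
`SquarefreeSums.exp_sub_one_le_two_mul` in `CoprimeSquarefreeSumsBounds.lean`; it is re-proved
here to keep this module's imports inside the `SmoothMajorant*`/`LinearEquationsInPrimes*`
family.) [folklore] -/
theorem exp_sub_one_le_two_mul_aux {x : ℝ} (h0 : 0 ≤ x) (h1 : x ≤ 1) :
    Real.exp x - 1 ≤ 2 * x := by
  have hx : |x| ≤ 1 := by rw [abs_of_nonneg h0]; exact h1
  have h := Real.abs_exp_sub_one_sub_id_le hx
  have h' : Real.exp x - 1 - x ≤ x ^ 2 := (le_abs_self _).trans h
  nlinarith [h', h0, h1]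


/-- `‖∏_{i ∈ s} (1 + u_i) - 1‖ ≤ ∏_{i ∈ s} (1 + ‖u_i‖) - 1`. [folklore] -/
theorem norm_prod_one_add_sub_one_le {α : Type*} (s : Finset α) (u : α → ℂ) :
    ‖∏ i ∈ s, (1 + u i) - 1‖ ≤ ∏ i ∈ s, (1 + ‖u i‖) - 1 := by
  classical
  induction s using Finset.induction_on with
  | empty => simp
  | insert a s ha ih =>
    rw [prod_insert ha, prod_insert ha]
    have hP : 0 ≤ ∏ i ∈ s, (1 + ‖u i‖) - 1 := by
      have : 1 ≤ ∏ i ∈ s, (1 + ‖u i‖) := by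
        calc (1 : ℝ) = ∏ _i ∈ s, (1 : ℝ) := by simp
          _ ≤ ∏ i ∈ s, (1 + ‖u i‖) :=
              prod_le_prod (fun _ _ => zero_le_one) fun i _ => by linarith [norm_nonneg (u i)]
      linarith
    have e : (1 + u a) * ∏ i ∈ s, (1 + u i) - 1 =
        (∏ i ∈ s, (1 + u i) - 1) + u a * ∏ i ∈ s, (1 + u i) := by ring
    rw [e]
    calc ‖(∏ i ∈ s, (1 + u i) - 1) + u a * ∏ i ∈ s, (1 + u i)‖
        ≤ ‖∏ i ∈ s, (1 + u i) - 1‖ + ‖u a‖ * ‖∏ i ∈ s, (1 + u i)‖ := by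
          rw [← norm_mul]; exact norm_add_le _ _
      _ ≤ (∏ i ∈ s, (1 + ‖u i‖) - 1) + ‖u a‖ * ∏ i ∈ s, (1 + ‖u i‖) := by
          refine add_le_add ih (mul_le_mul_of_nonneg_left ?_ (norm_nonneg _))
          rw [norm_prod]
          exact prod_le_prod (fun _ _ => norm_nonneg _) fun i _ => norm_add_le_of_le (by simp) le_rfl
      _ = (1 + ‖u a‖) * ∏ i ∈ s, (1 + ‖u i‖) - 1 := by ring

/-- `∏_{i ∈ s} (1 + a_i) ≤ exp(∑_{i ∈ s} a_i)` for `a_i ≥ 0`. [folklore] -/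
theorem prod_one_add_le_exp_sum {α : Type*} (s : Finset α) {a : α → ℝ} (ha : ∀ i ∈ s, 0 ≤ a i) :
    ∏ i ∈ s, (1 + a i) ≤ Real.exp (∑ i ∈ s, a i) := by
  rw [Real.exp_sum]
  exact prod_le_prod (fun i hi => by linarith [ha i hi]) fun i _ => by
    linarith [Real.add_one_le_exp (a i)]

/-- `‖(1 + e)⁻¹ - 1‖ ≤ 2‖e‖` for `2‖e‖ ≤ 1`. [folklore] -/
theorem norm_inv_one_add_sub_one_le_two_mul {e : ℂ} (he : 2 * ‖e‖ ≤ 1) : ‖(1 + e)⁻¹ - 1‖ ≤ 2 * ‖e‖ := by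
  have hn : (1 : ℝ) / 2 ≤ ‖1 + e‖ := by
    have := norm_sub_norm_le (1 : ℂ) (-e)
    rw [norm_one, norm_neg, sub_neg_eq_add] at this
    linarith
  have hne : (1 + e) ≠ 0 := fun h => by rw [h, norm_zero] at hn; linarith
  have eq : (1 + e)⁻¹ - 1 = -e / (1 + e) := by field_simp; ring
  rw [eq, norm_div, norm_neg, div_le_iff₀ (by linarith)]
  nlinarith [norm_nonneg e]

/-! ### The exponent `z(x)` and `a(x) = 1 - 2πix` -/

/-- `(log R) z(x) = a(x)`. [cite: GreenTao2010, App. D ("`z_{i,j} := (1 + iξ_{i,j})/log R`")] -/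
theorem log_mul_zOf {R : ℝ} (hR : 1 < R) (x : ℝ) : (Real.log R : ℂ) * zOf R x = aF x := by
  have hlog : (Real.log R : ℂ) ≠ 0 := by exact_mod_cast (Real.log_pos hR).ne'
  unfold zOf aF
  field_simp

/-- `‖a(x)‖ ≤ 1 + 2π|x|`. [folklore] -/
theorem norm_aF_le (x : ℝ) : ‖aF x‖ ≤ 1 + 2 * Real.pi * |x| := by
  unfold aF
  calc ‖(1 : ℂ) - 2 * Real.pi * x * Complex.I‖ ≤ ‖(1 : ℂ)‖ + ‖2 * (Real.pi : ℂ) * x * Complex.I‖ :=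
        norm_sub_le _ _
    _ = 1 + 2 * Real.pi * |x| := by
        rw [norm_one, norm_mul, norm_mul, norm_mul, Complex.norm_I, Complex.norm_real, Complex.norm_real,
          Real.norm_eq_abs, Real.norm_eq_abs, abs_of_pos Real.pi_pos, Complex.norm_ofNat]
        ring

/-- `‖a(x)‖ = (log R) ‖z(x)‖` for `R > 1`. [folklore] -/
theorem norm_aF_eq {R : ℝ} (hR : 1 < R) (x : ℝ) : ‖aF x‖ = Real.log R * ‖zOf R x‖ := by
  rw [← log_mul_zOf hR, norm_mul, Complex.norm_real, Real.norm_eq_abs, abs_of_pos (Real.log_pos hR)]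

/-! ### The small primes: `1/∏_{p ≤ w} (1 - p^{-1-z})` versus `W/φ(W)` -/

/-- `‖p^{-z} - 1‖ ≤ 2 ‖z‖ log p` when `‖z‖ log p ≤ 1` (`p^{-z} = e^{-z log p}`). [folklore] -/
theorem norm_cpow_neg_sub_one_le {p : ℕ} (hp : 0 < p) {z : ℂ} (hz : ‖z‖ * Real.log p ≤ 1) :
    ‖(p : ℂ) ^ (-z) - 1‖ ≤ 2 * ‖z‖ * Real.log p := by
  have hp0 : (p : ℂ) ≠ 0 := by exact_mod_cast hp.ne'
  rw [Complex.cpow_def_of_ne_zero hp0]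
  have hlog : Complex.log (p : ℂ) = (Real.log p : ℂ) := (Complex.natCast_log).symm
  rw [hlog]
  have hn : ‖(Real.log p : ℂ) * -z‖ ≤ 1 := by
    rw [norm_mul, norm_neg, Complex.norm_real, Real.norm_eq_abs,
      abs_of_nonneg (Real.log_natCast_nonneg p), mul_comm]
    exact hz
  calc ‖Complex.exp ((Real.log p : ℂ) * -z) - 1‖ ≤ 2 * ‖(Real.log p : ℂ) * -z‖ :=
        Complex.norm_exp_sub_one_le hn
    _ = 2 * ‖z‖ * Real.log p := by
        rw [norm_mul, norm_neg, Complex.norm_real, Real.norm_eq_abs,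
          abs_of_nonneg (Real.log_natCast_nonneg p)]
        ring

/-- The sum `S₁(w) = ∑_{p ≤ w} log p / p` controlling the small-prime factors. [folklore] -/
def logSum (w : ℕ) : ℝ := ∑ p ∈ (w + 1).primesBelow, Real.log p / p

/-- `S₁(w) ≥ 0`. [folklore] -/
theorem logSum_nonneg (w : ℕ) : 0 ≤ logSum w :=
  sum_nonneg fun p _ => div_nonneg (Real.log_natCast_nonneg p) (Nat.cast_nonneg p)

/-- Crude size: `S₁(w) ≤ (w+1) log(w+1)`. [folklore] -/
theorem logSum_le (w : ℕ) : logSum w ≤ (w + 1) * Real.log (w + 1) := by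
  unfold logSum
  have hterm : ∀ p ∈ (w + 1).primesBelow, Real.log p / p ≤ Real.log (w + 1) := by
    intro p hp
    have hp' := Nat.mem_primesBelow.1 hp
    have hp1 : (1 : ℝ) ≤ p := by exact_mod_cast hp'.2.one_lt.le
    calc Real.log p / p ≤ Real.log p / 1 := div_le_div_of_nonneg_left (Real.log_natCast_nonneg p) one_pos hp1
      _ = Real.log p := div_one _
      _ ≤ Real.log (w + 1) := Real.log_le_log (by linarith) (by exact_mod_cast hp'.1.le)
  calc ∑ p ∈ (w + 1).primesBelow, Real.log p / p ≤ ∑ _p ∈ (w + 1).primesBelow, Real.log (w + 1) :=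
        sum_le_sum hterm
    _ = ((w + 1).primesBelow.card : ℝ) * Real.log (w + 1) := by rw [sum_const, nsmul_eq_mul]
    _ ≤ (w + 1) * Real.log (w + 1) := by
        refine mul_le_mul_of_nonneg_right ?_ (Real.log_nonneg (by linarith))
        have : (w + 1).primesBelow.card ≤ w + 1 := by
          calc (w + 1).primesBelow.card ≤ (range (w + 1)).card := card_le_card (Finset.filter_subset _ _)
            _ = w + 1 := card_range _
        exact_mod_cast this

/-- **The small-prime ratio is `1 + O(‖z‖ ∑_{p≤w} log p/p)`**:
`‖∏_{p ≤ w} (1 - 1/p)/(1 - p^{-1-z}) - 1‖ ≤ exp(4‖z‖ S₁(w)) - 1` when `Re z ≥ 0` and `‖z‖ log(w+1) ≤ 1`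
("`∏_{p ≤ w} β_p = (W/φ(W))^{|B|}`" up to this error, at `z ≠ 0`). [cite: GreenTao2010, App. D, p. 1834 and Lemma D.5] -/
theorem norm_smallRatio_sub_one_le (w : ℕ) {z : ℂ} (hz : 0 ≤ z.re) (hzw : ‖z‖ * Real.log (w + 1) ≤ 1) :
    ‖(∏ p ∈ (w + 1).primesBelow, ((1 - (p : ℂ)⁻¹) / (1 - (p : ℂ) ^ (-(1 + z))))) - 1‖ ≤
      Real.exp (4 * ‖z‖ * logSum w) - 1 := by
  -- the per-prime deviation
  set u : ℕ → ℂ := fun p => (1 - (p : ℂ)⁻¹) / (1 - (p : ℂ) ^ (-(1 + z))) - 1 with hu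
  have hprod : ∏ p ∈ (w + 1).primesBelow, ((1 - (p : ℂ)⁻¹) / (1 - (p : ℂ) ^ (-(1 + z)))) =
      ∏ p ∈ (w + 1).primesBelow, (1 + u p) := prod_congr rfl fun p _ => by simp only [hu]; ring
  have hup : ∀ p ∈ (w + 1).primesBelow, ‖u p‖ ≤ 4 * ‖z‖ * (Real.log p / p) := by
    intro p hp
    obtain ⟨hpw, hpp⟩ := Nat.mem_primesBelow.1 hp
    have hp0 : (0 : ℝ) < p := by exact_mod_cast hpp.pos
    have hp2 : (2 : ℝ) ≤ p := by exact_mod_cast hpp.two_le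
    have hpC : (p : ℂ) ≠ 0 := by exact_mod_cast hpp.ne_zero
    -- `1 - p^{-1-z} ≠ 0` with `‖·‖ ≥ 1/2`
    have hq : ‖(p : ℂ) ^ (-(1 + z))‖ ≤ 1 / p := by
      rw [Complex.norm_natCast_cpow_of_pos hpp.pos]
      calc (p : ℝ) ^ ((-(1 + z)).re) ≤ (p : ℝ) ^ (-1 : ℝ) := by
            refine Real.rpow_le_rpow_of_exponent_le (by linarith) ?_
            simp only [Complex.neg_re, Complex.add_re, Complex.one_re]; linarith
        _ = 1 / p := by rw [Real.rpow_neg_one, one_div]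
    have hden : (1 : ℝ) / 2 ≤ ‖1 - (p : ℂ) ^ (-(1 + z))‖ := by
      have := norm_sub_norm_le (1 : ℂ) ((p : ℂ) ^ (-(1 + z)))
      rw [norm_one] at this
      have : (1 : ℝ) / p ≤ 1 / 2 := by rw [div_le_div_iff₀ hp0 two_pos]; linarith
      linarith
    have hne : (1 : ℂ) - (p : ℂ) ^ (-(1 + z)) ≠ 0 := fun h => by
      rw [h, norm_zero] at hden; linarith
    -- `u p = (p^{-1-z} - p^{-1})/(1 - p^{-1-z})`, `p^{-1-z} - p^{-1} = p^{-1}(p^{-z} - 1)`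
    have hq' : (p : ℂ) ^ (-(1 + z)) = (p : ℂ)⁻¹ * (p : ℂ) ^ (-z) := by
      rw [neg_add, Complex.cpow_add _ _ hpC, Complex.cpow_neg_one]
    have e1 : u p = ((p : ℂ)⁻¹ * ((p : ℂ) ^ (-z) - 1)) / (1 - (p : ℂ) ^ (-(1 + z))) := by
      simp only [hu]
      rw [div_sub_one hne]
      congr 1
      rw [hq']
      ring
    have hzp : ‖z‖ * Real.log p ≤ 1 := by
      calc ‖z‖ * Real.log p ≤ ‖z‖ * Real.log (w + 1) := by
            refine mul_le_mul_of_nonneg_left (Real.log_le_log hp0 ?_) (norm_nonneg _)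
            exact_mod_cast hpw.le
        _ ≤ 1 := hzw
    rw [e1, norm_div, norm_mul, norm_inv, Complex.norm_natCast, div_le_iff₀ (by linarith)]
    calc (p : ℝ)⁻¹ * ‖(p : ℂ) ^ (-z) - 1‖ ≤ (p : ℝ)⁻¹ * (2 * ‖z‖ * Real.log p) :=
          mul_le_mul_of_nonneg_left (norm_cpow_neg_sub_one_le hpp.pos hzp) (by positivity)
      _ = 4 * ‖z‖ * (Real.log p / p) * (1 / 2) := by field_simp; ring
      _ ≤ 4 * ‖z‖ * (Real.log p / p) * ‖1 - (p : ℂ) ^ (-(1 + z))‖ :=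
          mul_le_mul_of_nonneg_left hden (by
            have := Real.log_natCast_nonneg p; positivity)
  rw [hprod]
  calc ‖∏ p ∈ (w + 1).primesBelow, (1 + u p) - 1‖ ≤ ∏ p ∈ (w + 1).primesBelow, (1 + ‖u p‖) - 1 :=
        norm_prod_one_add_sub_one_le _ _
    _ ≤ Real.exp (∑ p ∈ (w + 1).primesBelow, ‖u p‖) - 1 := by
        linarith [prod_one_add_le_exp_sum ((w + 1).primesBelow) (a := fun p => ‖u p‖)
          fun p _ => norm_nonneg _]
    _ ≤ Real.exp (4 * ‖z‖ * logSum w) - 1 := by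
        gcongr
        unfold logSum
        rw [mul_sum]
        exact sum_le_sum hup

/-- **`‖1/∏_{p ≤ w}(1 - p^{-1-z})‖ ≤ W/φ(W)`** for `Re z ≥ 0` (`|1 - p^{-1-z}| ≥ 1 - 1/p` and
`∏_{p≤w} (1 - 1/p) = φ(W)/W`). [cite: GreenTao2010, App. D, p. 1834 ("`∏_{p ≤ w} β_p = (W/φ(W))^{|B|}`")] -/
theorem norm_inv_prod_small_le (w : ℕ) {z : ℂ} (hz : 0 ≤ z.re) :
    ‖(∏ p ∈ (w + 1).primesBelow, (1 - (p : ℂ) ^ (-(1 + z))))⁻¹‖ ≤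
      (primorial w : ℝ) / Nat.totient (primorial w) := by
  have hφ := totient_primorial_div w
  have hW0 : (0 : ℝ) < primorial w := by exact_mod_cast primorial_pos w
  have hφ0 : (0 : ℝ) < Nat.totient (primorial w) := by exact_mod_cast Nat.totient_pos.2 (primorial_pos w)
  have hlow : ∏ p ∈ (w + 1).primesBelow, (1 - (p : ℝ)⁻¹) ≤ ‖∏ p ∈ (w + 1).primesBelow, (1 - (p : ℂ) ^ (-(1 + z)))‖ := by
    rw [norm_prod]
    refine prod_le_prod (fun p hp => ?_) fun p hp => ?_
    · have hp2 : (2 : ℝ) ≤ p := by exact_mod_cast (Nat.mem_primesBelow.1 hp).2.two_le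
      have : (p : ℝ)⁻¹ ≤ 1 / 2 := by
        rw [inv_eq_one_div, div_le_div_iff₀ (by linarith) two_pos]; linarith
      linarith
    · have hpp := (Nat.mem_primesBelow.1 hp).2
      have hq : ‖(p : ℂ) ^ (-(1 + z))‖ ≤ (p : ℝ)⁻¹ := by
        rw [Complex.norm_natCast_cpow_of_pos hpp.pos]
        calc (p : ℝ) ^ ((-(1 + z)).re) ≤ (p : ℝ) ^ (-1 : ℝ) := by
              refine Real.rpow_le_rpow_of_exponent_le (by exact_mod_cast hpp.one_lt.le) ?_
              simp only [Complex.neg_re, Complex.add_re, Complex.one_re]; linarith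
          _ = (p : ℝ)⁻¹ := Real.rpow_neg_one _
      have := norm_sub_norm_le (1 : ℂ) ((p : ℂ) ^ (-(1 + z)))
      rw [norm_one] at this
      linarith
  have hposprod : 0 < ∏ p ∈ (w + 1).primesBelow, (1 - (p : ℝ)⁻¹) := by
    rw [← hφ]; positivity
  rw [norm_inv, inv_le_comm₀ (lt_of_lt_of_le hposprod hlow) (by positivity)]
  calc ((primorial w : ℝ) / Nat.totient (primorial w))⁻¹ = (Nat.totient (primorial w) : ℝ) / primorial w := by
        rw [inv_div]
    _ = ∏ p ∈ (w + 1).primesBelow, (1 - (p : ℝ)⁻¹) := hφ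
    _ ≤ _ := hlow

/-- The normalised small-prime factor `ρ(z) = (φ(W)/W)/∏_{p≤w}(1 - p^{-1-z}) = ∏_{p≤w} (1-1/p)/(1-p^{-1-z})`.
[cite: GreenTao2010, App. D, p. 1834] -/
theorem smallRatio_eq (w : ℕ) (z : ℂ) :
    ((Nat.totient (primorial w) : ℂ) / primorial w) * (∏ p ∈ (w + 1).primesBelow, (1 - (p : ℂ) ^ (-(1 + z))))⁻¹ =
      ∏ p ∈ (w + 1).primesBelow, ((1 - (p : ℂ)⁻¹) / (1 - (p : ℂ) ^ (-(1 + z)))) := by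
  have hφ := totient_primorial_div w
  have hφC : ((Nat.totient (primorial w) : ℂ) / primorial w) = ∏ p ∈ (w + 1).primesBelow, (1 - (p : ℂ)⁻¹) := by
    have := congrArg (fun r : ℝ => (r : ℂ)) hφ
    push_cast at this
    exact this
  rw [hφC, prod_div_distrib, div_eq_mul_inv]

/-! ### The zeta factor: `(log R) ζ(1+z)^{-1}` versus `a(x)` -/

/-- **`‖ζ(1+z)^{-1}‖ ≤ 1/Re z + C`** for `0 < Re z ≤ 1` (the Euler product `∏_p (1 - p^{-1-z})` is
dominated by `∏_p (1 + p^{-1-σ}) ≤ ζ(1+σ) = 1/σ + O(1)`; "`ζ(s) = 1/(s-1) + O(1)`", (D.9')).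
[cite: GreenTao2010, App. D, (D.9') ("Since the Riemann zeta function … has a simple pole at `s=1`")] -/
theorem exists_norm_inv_zeta_le : ∃ C : ℝ, 0 ≤ C ∧ ∀ z : ℂ, 0 < z.re → z.re ≤ 1 →
    ‖(riemannZeta (1 + z))⁻¹‖ ≤ 1 / z.re + C := by
  obtain ⟨C, hC0, hC⟩ := exists_prod_one_add_mul_rpow_le
  refine ⟨C, hC0, fun z hz0 hz1 => ?_⟩
  have h1 : 1 < (1 + z).re := by simp; exact hz0
  have hlim := (tendsto_prod_one_sub_cpow h1).norm
  refine le_of_tendsto' hlim fun n => ?_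
  rw [norm_prod]
  have hσ1 : 1 < 1 + z.re := by linarith
  have hσ2 : 1 + z.re ≤ 2 := by linarith
  have h := hC 1 (1 + z.re) hσ1 hσ2 n
  rw [pow_one, show 1 + z.re - 1 = z.re by ring] at h
  refine le_trans (prod_le_prod (fun _ _ => norm_nonneg _) fun p hp => ?_) h
  have hpp := (Nat.mem_primesBelow.1 hp).2
  push_cast
  rw [one_mul]
  calc ‖1 - (p : ℂ) ^ (-(1 + z))‖ ≤ ‖(1 : ℂ)‖ + ‖(p : ℂ) ^ (-(1 + z))‖ := norm_sub_le _ _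
    _ = 1 + (p : ℝ) ^ (-(1 + z.re)) := by
        rw [norm_one, Complex.norm_natCast_cpow_of_pos hpp.pos]
        simp

/-- **`(log R) ζ(1+z)^{-1} = a(x) (zζ(1+z))^{-1}`** at `z = z(x)`, `R > 1` (algebra; `z ≠ 0`,
`ζ(1+z) ≠ 0`). [folklore] -/
theorem log_mul_inv_zeta_eq {R : ℝ} (hR : 1 < R) (x : ℝ) :
    (Real.log R : ℂ) * (riemannZeta (1 + zOf R x))⁻¹ =
      aF x * (zOf R x * riemannZeta (1 + zOf R x))⁻¹ := by
  have hz : zOf R x ≠ 0 := (zOf_ne_zero hR x x).1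
  have hζ : riemannZeta (1 + zOf R x) ≠ 0 :=
    riemannZeta_ne_zero_of_one_lt_re (by simp [zOf_re]; exact Real.log_pos hR)
  rw [← log_mul_zOf hR x, mul_inv]
  field_simp

/-! ### The one-dimensional main factor and its comparison with `a(x)` -/

/-- **The normalised one-dimensional main factor**
`F̃(x) = (log R) ζ(1+z(x))^{-1} · (φ(W)/W)/∏_{p≤w}(1 - p^{-1-z(x)})` (so that
`log^{|ι|} R · (∏_i ζ(1+z_i)^{-1}) / ∏_{p≤w} E'_p = (W/φ(W))^{|ι|} ∏_i F̃(η_i)`); its integral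
against `φ` tends to `c_{χ,1} = -χ'(0)`. [cite: GreenTao2010, App. D, (D.16)–(D.17) with `a_i = 1`] -/
def mainFactor (R : ℝ) (w : ℕ) (x : ℝ) : ℂ :=
  (Real.log R : ℂ) * (riemannZeta (1 + zOf R x))⁻¹ *
    (((Nat.totient (primorial w) : ℂ) / primorial w) *
      (∏ p ∈ (w + 1).primesBelow, (1 - (p : ℂ) ^ (-(1 + zOf R x))))⁻¹)

/-- **Crude bound, all `x`**: `‖F̃(x)‖ ≤ (log R)(log R + C)` for `log R ≥ 1` (this controls the
tail `|x| > log^{1/2} R`, cf. "(euler-2) … `∏_p |E'_{p,ξ}| ≪ log^{-t} R ∏ (1+|ξ_{i,j}|)^{O(1)}`").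
[cite: GreenTao2010, App. D, (D.17)] -/
theorem norm_mainFactor_le_crude {C : ℝ} (hC : ∀ z : ℂ, 0 < z.re → z.re ≤ 1 →
      ‖(riemannZeta (1 + z))⁻¹‖ ≤ 1 / z.re + C) {R : ℝ} (hR : Real.exp 1 ≤ R) (w : ℕ) (x : ℝ) :
    ‖mainFactor R w x‖ ≤ Real.log R * (Real.log R + C) := by
  have hR1 : 1 < R := lt_of_lt_of_le (by have := Real.exp_one_gt_d9; linarith) hR
  have hlogR : 1 ≤ Real.log R := by rwa [Real.le_log_iff_exp_le (by linarith)]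
  have hre : 0 < (zOf R x).re := by rw [zOf_re]; positivity
  have hre1 : (zOf R x).re ≤ 1 := by rw [zOf_re, div_le_one (by linarith)]; exact hlogR
  have hζ := hC (zOf R x) hre hre1
  rw [zOf_re, one_div_one_div] at hζ
  have hsmall : ‖((Nat.totient (primorial w) : ℂ) / primorial w) *
      (∏ p ∈ (w + 1).primesBelow, (1 - (p : ℂ) ^ (-(1 + zOf R x))))⁻¹‖ ≤ 1 := by
    have hW0 : (0 : ℝ) < primorial w := by exact_mod_cast primorial_pos w
    have hφ0 : (0 : ℝ) < Nat.totient (primorial w) := by exact_mod_cast Nat.totient_pos.2 (primorial_pos w)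
    rw [norm_mul]
    have h1 : ‖((Nat.totient (primorial w) : ℂ) / primorial w)‖ = (Nat.totient (primorial w) : ℝ) / primorial w := by
      rw [norm_div, Complex.norm_natCast, Complex.norm_natCast]
    rw [h1]
    calc (Nat.totient (primorial w) : ℝ) / primorial w *
          ‖(∏ p ∈ (w + 1).primesBelow, (1 - (p : ℂ) ^ (-(1 + zOf R x))))⁻¹‖
        ≤ (Nat.totient (primorial w) : ℝ) / primorial w * ((primorial w : ℝ) / Nat.totient (primorial w)) :=
          mul_le_mul_of_nonneg_left (norm_inv_prod_small_le w hre.le) (by positivity)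
      _ = 1 := by field_simp
  unfold mainFactor
  rw [norm_mul, norm_mul, Complex.norm_real, Real.norm_eq_abs, abs_of_pos (by linarith)]
  calc Real.log R * ‖(riemannZeta (1 + zOf R x))⁻¹‖ * _ ≤ Real.log R * (Real.log R + C) * 1 :=
        mul_le_mul (mul_le_mul_of_nonneg_left hζ (by linarith)) hsmall (norm_nonneg _) (by
          have : 0 ≤ ‖(riemannZeta (1 + zOf R x))⁻¹‖ := norm_nonneg _; nlinarith)
    _ = Real.log R * (Real.log R + C) := mul_one _

/-- **Main comparison, small `z`**: with `C₁` the constant of `|zζ(1+z) - 1| ≤ C₁|z|`, if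
`‖z(x)‖ ≤ 1`, `C₁‖z(x)‖ ≤ 1/2`, `‖z(x)‖ log(w+1) ≤ 1` and `4‖z(x)‖ S₁(w) ≤ 1`, then
`‖F̃(x) - a(x)‖ ≤ ‖a(x)‖ ‖z(x)‖ (2C₁ + 8 S₁(w))` ("`∏_p E'_p = (1 + O(log^{-1/2} R)) ∏ (∑ z)^{±1}`",
(D.14), together with the small-prime factor). [cite: GreenTao2010, App. D, (D.14) and Lemma D.5] -/
theorem norm_mainFactor_sub_aF_le {C₁ : ℝ} (hC₁0 : 0 ≤ C₁)
    (hC₁ : ∀ u : ℂ, u ≠ 0 → ‖u‖ ≤ 1 → ‖u * riemannZeta (1 + u) - 1‖ ≤ C₁ * ‖u‖)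
    {R : ℝ} (hR : 1 < R) (w : ℕ) (x : ℝ) (hz1 : ‖zOf R x‖ ≤ 1) (hzC : C₁ * ‖zOf R x‖ ≤ 1 / 2)
    (hzw : ‖zOf R x‖ * Real.log (w + 1) ≤ 1) (hzS : 4 * ‖zOf R x‖ * logSum w ≤ 1) :
    ‖mainFactor R w x - aF x‖ ≤ ‖aF x‖ * ‖zOf R x‖ * (2 * C₁ + 8 * logSum w) := by
  set z := zOf R x with hzdef
  have hz0 : z ≠ 0 := (zOf_ne_zero hR x x).1
  have hre : 0 ≤ z.re := by rw [hzdef, zOf_re]; exact div_nonneg zero_le_one (Real.log_pos hR).le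
  -- the two factors
  set e₁ : ℂ := z * riemannZeta (1 + z) - 1 with he₁
  set ρ : ℂ := ((Nat.totient (primorial w) : ℂ) / primorial w) *
    (∏ p ∈ (w + 1).primesBelow, (1 - (p : ℂ) ^ (-(1 + z))))⁻¹ with hρ
  have hF : mainFactor R w x = aF x * ((1 + e₁)⁻¹ * ρ) := by
    unfold mainFactor
    rw [← hzdef, log_mul_inv_zeta_eq hR x, ← hzdef, ← hρ]
    have : z * riemannZeta (1 + z) = 1 + e₁ := by rw [he₁]; ring
    rw [this]; ring
  have he₁b : ‖e₁‖ ≤ C₁ * ‖z‖ := hC₁ z hz0 hz1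
  have he₁h : ‖e₁‖ ≤ 1 / 2 := he₁b.trans hzC
  have hinv : ‖(1 + e₁)⁻¹ - 1‖ ≤ 2 * (C₁ * ‖z‖) :=
    (norm_inv_one_add_sub_one_le_two_mul (by linarith)).trans (by linarith)
  have hρ1 : ‖ρ‖ ≤ 1 := by
    have hW0 : (0 : ℝ) < primorial w := by exact_mod_cast primorial_pos w
    have hφ0 : (0 : ℝ) < Nat.totient (primorial w) := by exact_mod_cast Nat.totient_pos.2 (primorial_pos w)
    rw [hρ, norm_mul, norm_div, Complex.norm_natCast, Complex.norm_natCast]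
    calc (Nat.totient (primorial w) : ℝ) / primorial w * ‖(∏ p ∈ (w + 1).primesBelow, (1 - (p : ℂ) ^ (-(1 + z))))⁻¹‖
        ≤ (Nat.totient (primorial w) : ℝ) / primorial w * ((primorial w : ℝ) / Nat.totient (primorial w)) :=
          mul_le_mul_of_nonneg_left (norm_inv_prod_small_le w hre) (by positivity)
      _ = 1 := by field_simp
  have hρsub : ‖ρ - 1‖ ≤ 8 * ‖z‖ * logSum w := by
    rw [hρ, smallRatio_eq w z]
    refine (norm_smallRatio_sub_one_le w hre hzw).trans ?_
    have h0 : 0 ≤ 4 * ‖z‖ * logSum w := by have := logSum_nonneg w; positivity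
    calc Real.exp (4 * ‖z‖ * logSum w) - 1 ≤ 2 * (4 * ‖z‖ * logSum w) := exp_sub_one_le_two_mul_aux h0 hzS
      _ = 8 * ‖z‖ * logSum w := by ring
  -- combine: `(1+e₁)⁻¹ ρ - 1 = ((1+e₁)⁻¹ - 1) ρ + (ρ - 1)`
  have hcomb : ‖(1 + e₁)⁻¹ * ρ - 1‖ ≤ ‖z‖ * (2 * C₁ + 8 * logSum w) := by
    have e : (1 + e₁)⁻¹ * ρ - 1 = ((1 + e₁)⁻¹ - 1) * ρ + (ρ - 1) := by ring
    rw [e]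
    calc ‖((1 + e₁)⁻¹ - 1) * ρ + (ρ - 1)‖ ≤ ‖(1 + e₁)⁻¹ - 1‖ * ‖ρ‖ + ‖ρ - 1‖ := by
          rw [← norm_mul]; exact norm_add_le _ _
      _ ≤ 2 * (C₁ * ‖z‖) * 1 + 8 * ‖z‖ * logSum w :=
          add_le_add (mul_le_mul hinv hρ1 (norm_nonneg _) (by positivity)) hρsub
      _ = ‖z‖ * (2 * C₁ + 8 * logSum w) := by ring
  rw [hF, show aF x * ((1 + e₁)⁻¹ * ρ) - aF x = aF x * ((1 + e₁)⁻¹ * ρ - 1) by ring, norm_mul]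
  calc ‖aF x‖ * ‖(1 + e₁)⁻¹ * ρ - 1‖ ≤ ‖aF x‖ * (‖z‖ * (2 * C₁ + 8 * logSum w)) :=
        mul_le_mul_of_nonneg_left hcomb (norm_nonneg _)
    _ = ‖aF x‖ * ‖z‖ * (2 * C₁ + 8 * logSum w) := by ring

/-! ### Continuity and integrability of the main factor -/

/-- `x ↦ ζ(1 + z(x))⁻¹` is continuous (`ζ` is analytic off `s = 1`, `Re(1+z) > 1`, `ζ ≠ 0` there).
[folklore] -/
theorem continuous_inv_zeta_zOf {R : ℝ} (hR : 1 < R) :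
    Continuous fun x : ℝ => (riemannZeta (1 + zOf R x))⁻¹ := by
  have hre : ∀ x : ℝ, 1 < (1 + zOf R x).re := fun x => by
    simp [zOf_re]; exact Real.log_pos hR
  have hin : Continuous fun x : ℝ => (1 : ℂ) + zOf R x := continuous_const.add (continuous_zOf R)
  have h1 : Continuous fun x : ℝ => riemannZeta (1 + zOf R x) := by
    refine continuous_iff_continuousAt.2 fun x => ?_
    have hne : (1 + zOf R x) ≠ 1 := fun h => by
      have := hre x; rw [h] at this; simp at this
    exact ContinuousAt.comp (g := riemannZeta) (f := fun x : ℝ => (1 : ℂ) + zOf R x) (x := x)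
      (differentiableAt_riemannZeta hne).continuousAt hin.continuousAt
  exact h1.inv₀ fun x => riemannZeta_ne_zero_of_one_lt_re (hre x)

/-- `x ↦ (∏_{p≤w} (1 - p^{-1-z(x)}))⁻¹` is continuous. [folklore] -/
theorem continuous_inv_prod_small {R : ℝ} (hR : 1 < R) (w : ℕ) :
    Continuous fun x : ℝ => (∏ p ∈ (w + 1).primesBelow, (1 - (p : ℂ) ^ (-(1 + zOf R x))))⁻¹ := by
  have hre : ∀ x : ℝ, 0 ≤ (zOf R x).re := fun x => by
    rw [zOf_re]; exact div_nonneg zero_le_one (Real.log_pos hR).le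
  have hc : Continuous fun x : ℝ => ∏ p ∈ (w + 1).primesBelow, (1 - (p : ℂ) ^ (-(1 + zOf R x))) := by
    refine continuous_finsetProd _ fun p hp => continuous_const.sub ?_
    have hp0 : (p : ℂ) ≠ 0 := by exact_mod_cast (Nat.mem_primesBelow.1 hp).2.ne_zero
    exact Continuous.const_cpow ((continuous_const.add (continuous_zOf R)).neg) (Or.inl hp0)
  refine hc.inv₀ fun x => prod_ne_zero_iff.2 fun p hp => ?_
  have hpp := (Nat.mem_primesBelow.1 hp).2
  intro h
  have h1 : (p : ℂ) ^ (-(1 + zOf R x)) = 1 := by linear_combination -h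
  have hq : ‖(p : ℂ) ^ (-(1 + zOf R x))‖ ≤ 1 / p := by
    rw [Complex.norm_natCast_cpow_of_pos hpp.pos]
    calc (p : ℝ) ^ ((-(1 + zOf R x)).re) ≤ (p : ℝ) ^ (-1 : ℝ) := by
          refine Real.rpow_le_rpow_of_exponent_le (by exact_mod_cast hpp.one_lt.le) ?_
          simp only [Complex.neg_re, Complex.add_re, Complex.one_re]; linarith [hre x]
      _ = 1 / p := by rw [Real.rpow_neg_one, one_div]
  rw [h1, norm_one] at hq
  have hp2 : (2 : ℝ) ≤ p := by exact_mod_cast hpp.two_le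
  have : (1 : ℝ) / p ≤ 1 / 2 := by rw [div_le_div_iff₀ (by linarith) two_pos]; linarith
  linarith

/-- `F̃` is continuous. [folklore] -/
theorem continuous_mainFactor {R : ℝ} (hR : 1 < R) (w : ℕ) : Continuous (mainFactor R w) := by
  unfold mainFactor
  exact (continuous_const.mul (continuous_inv_zeta_zOf hR)).mul
    (continuous_const.mul (continuous_inv_prod_small hR w))

variable {χ : ℝ → ℝ} (hs : ContDiff ℝ (⊤ : ℕ∞) χ) (hsupp : ∀ x, 1 ≤ |x| → χ x = 0)
include hs hsupp

/-- **`∫ φ(x) a(x) dx = -χ'(0) = c_{χ,1}`** (Lemma D.2 with `a = 1`, "`c_{χ,1} = ∫ (1+iξ)φ(ξ) dξ = -χ'(0)`";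
here `φ` in Mathlib's normalisation, `a(x) = 1 - 2πix`). [cite: GreenTao2010, App. D, Lemma D.2] -/
theorem integral_phiF_mul_aF : ∫ x, phiF χ x * aF x = -((deriv χ 0 : ℝ) : ℂ) := by
  have h := integral_aF_phiF_exp hs hsupp 0
  rw [← h]
  refine integral_congr_ae (Filter.Eventually.of_forall fun x => ?_)
  simp only [Complex.ofReal_zero, mul_zero, Complex.exp_zero, mul_one]
  ring

/-- `φ F̃` is integrable (`φ` integrable, `F̃` continuous and bounded). [folklore] -/
theorem integrable_phiF_mul_mainFactor {C : ℝ} (hC : ∀ z : ℂ, 0 < z.re → z.re ≤ 1 →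
      ‖(riemannZeta (1 + z))⁻¹‖ ≤ 1 / z.re + C) {R : ℝ} (hR : Real.exp 1 ≤ R) (w : ℕ) :
    Integrable fun x => phiF χ x * mainFactor R w x := by
  have hR1 : 1 < R := lt_of_lt_of_le (by have := Real.exp_one_gt_d9; linarith) hR
  have h := (phiF_integrable hs hsupp).bdd_mul (continuous_mainFactor hR1 w).aestronglyMeasurable
    (Filter.Eventually.of_forall fun x => norm_mainFactor_le_crude hC hR w x)
  refine h.congr (Filter.Eventually.of_forall fun x => ?_)
  ring

omit hs hsupp in
/-- The tail algebra: for `y ≥ T = L^{1/2} ≥ 1`,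
`CA y^{-8} (L(L+C₂)+7) y ≤ CA (8+C₂) T^{-1} y^{-2}`. [folklore] -/
theorem tail_algebra {CA C₂ L T y : ℝ} (hCA : 0 ≤ CA) (hC₂ : 0 ≤ C₂) (hL1 : 1 ≤ L) (hT0 : 0 < T)
    (hT2 : T ^ 2 = L) (hy : T ≤ y) (hy0 : 0 < y) :
    CA * (y ^ 8)⁻¹ * ((L * (L + C₂) + 7) * y) ≤ CA * (8 + C₂) / T * (y⁻¹) ^ 2 := by
  set u : ℝ := y⁻¹ with hu
  have hu0 : 0 ≤ u := by rw [hu]; positivity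
  have huT : u ≤ T⁻¹ := by rw [hu]; exact inv_anti₀ hT0 hy
  have hu5 : u ^ 5 ≤ (T⁻¹) ^ 5 := pow_le_pow_left₀ hu0 huT 5
  have hT4 : T ^ 4 = L ^ 2 := by rw [show T ^ 4 = (T ^ 2) ^ 2 by ring, hT2]
  have hM : L * (L + C₂) + 7 ≤ (8 + C₂) * L ^ 2 := by
    have hLL : L ≤ L ^ 2 := by nlinarith
    have h1 : C₂ * L ≤ C₂ * L ^ 2 := mul_le_mul_of_nonneg_left hLL hC₂
    nlinarith
  have eL : (y ^ 8)⁻¹ * ((L * (L + C₂) + 7) * y) = (L * (L + C₂) + 7) * u ^ 5 * u ^ 2 := by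
    rw [hu]; field_simp
  have eT : (8 + C₂) * L ^ 2 * (T⁻¹) ^ 5 = (8 + C₂) / T := by
    rw [← hT4]; field_simp
  have h82L : 0 ≤ (8 + C₂) * L ^ 2 := mul_nonneg (by linarith) (sq_nonneg L)
  have hkey : (L * (L + C₂) + 7) * u ^ 5 ≤ (8 + C₂) / T := by
    calc (L * (L + C₂) + 7) * u ^ 5 ≤ (8 + C₂) * L ^ 2 * u ^ 5 :=
          mul_le_mul_of_nonneg_right hM (pow_nonneg hu0 5)
      _ ≤ (8 + C₂) * L ^ 2 * (T⁻¹) ^ 5 := mul_le_mul_of_nonneg_left hu5 h82L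
      _ = (8 + C₂) / T := eT
  rw [mul_assoc, eL]
  have hu2 : 0 ≤ u ^ 2 := pow_nonneg hu0 2
  calc CA * ((L * (L + C₂) + 7) * u ^ 5 * u ^ 2) = CA * ((L * (L + C₂) + 7) * u ^ 5) * u ^ 2 := by ring
    _ ≤ CA * ((8 + C₂) / T) * u ^ 2 :=
        mul_le_mul_of_nonneg_right (mul_le_mul_of_nonneg_left hkey hCA) hu2
    _ = CA * (8 + C₂) / T * u ^ 2 := by ring

/-! ### The one-dimensional integral: `∫ φ F̃ = -χ'(0) + O((1 + S₁(w)) log^{-1/2} R)` -/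

/-- **The one-dimensional main-term integral** ((D.16)–(D.17) with `a = 1`, one factor): there
are `K, C₀` (depending on `χ` only) such that for `R ≥ e` and `C₀ (1 + log(w+1) + S₁(w)) ≤ log^{1/2} R`,
`‖∫ φ F̃ - ∫ φ a‖ ≤ K (1 + S₁(w)) log^{-1/2} R` and `∫ |φ F̃| ≤ K` — the range `|x| ≤ log^{1/2} R`
by the pointwise comparison `norm_mainFactor_sub_aF_le`, the tail by the decay of `φ` ("The first
move is to reinstate the integrals over all of `ℝ` … an error which is `≪_A log^{-A} R`").
[cite: GreenTao2010, App. D, (D.16)–(D.17)] -/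
theorem exists_mainFactor_integral_bound :
    ∃ K C₀ : ℝ, 0 ≤ K ∧ 1 ≤ C₀ ∧ ∀ (R : ℝ) (w : ℕ), Real.exp 1 ≤ R →
      C₀ * (1 + Real.log (w + 1) + logSum w) ≤ Real.sqrt (Real.log R) →
        ‖(∫ x, phiF χ x * mainFactor R w x) - ∫ x, phiF χ x * aF x‖ ≤
            K * (1 + logSum w) / Real.sqrt (Real.log R) ∧
          ∫ x, ‖phiF χ x * mainFactor R w x‖ ≤ K := by
  obtain ⟨C₁, hC₁0, hC₁⟩ := exists_bound_zeta_one_add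
  obtain ⟨C₂, hC₂0, hC₂⟩ := exists_norm_inv_zeta_le
  obtain ⟨CA, hCA0, hφA⟩ := norm_phiF_le hs hsupp 8
  have hφWi := integrable_phiWeight hs hsupp
  have htaili : Integrable fun x : ℝ => (1 + ‖x‖) ^ (-(2 : ℝ)) := integrable_one_add_norm (by simp)
  set I₁ : ℝ := ∫ x, phiWeight χ x with hI₁
  set I₂ : ℝ := ∫ x : ℝ, (1 + ‖x‖) ^ (-(2 : ℝ)) with hI₂
  have hI₁0 : 0 ≤ I₁ := integral_nonneg fun x => by unfold phiWeight; positivity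
  have hI₂0 : 0 ≤ I₂ := integral_nonneg fun x => by positivity
  set K₀ : ℝ := 64 * (C₁ + 1) * I₁ + CA * (8 + C₂) * I₂ with hK₀
  have hK₀0 : 0 ≤ K₀ := by positivity
  set C₀ : ℝ := 32 * (2 * C₁ + 1) with hC₀
  have hC₀32 : 32 ≤ C₀ := by rw [hC₀]; nlinarith
  refine ⟨K₀ + I₁, C₀, by positivity, by linarith, fun R w hR hRw => ?_⟩
  -- basic quantities
  have hR1 : 1 < R := lt_of_lt_of_le (by have := Real.exp_one_gt_d9; linarith) hR
  set L : ℝ := Real.log R with hL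
  have hL1 : 1 ≤ L := by rw [hL]; rwa [Real.le_log_iff_exp_le (by linarith)]
  set T : ℝ := Real.sqrt L with hT
  have hT0 : 0 < T := Real.sqrt_pos.2 (by linarith)
  have hT2 : T ^ 2 = L := Real.sq_sqrt (by linarith)
  have hT1 : 1 ≤ T := by rw [hT]; exact Real.one_le_sqrt.2 hL1
  have hS0 := logSum_nonneg w
  have hlogw : 0 ≤ Real.log (w + 1) := Real.log_nonneg (by exact_mod_cast Nat.le_add_left 1 w)
  have hsum1 : 1 ≤ 1 + Real.log (w + 1) + logSum w := by linarith
  have hTC₀ : C₀ ≤ T := le_trans (le_mul_of_one_le_right (by linarith) hsum1) hRw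
  have hT32 : 32 ≤ T := hC₀32.trans hTC₀
  -- `‖z(x)‖ ≤ 8/T` on `|x| ≤ T`
  have hzT : ∀ x : ℝ, |x| ≤ T → ‖zOf R x‖ ≤ 8 / T := by
    intro x hx
    calc ‖zOf R x‖ ≤ (1 + 2 * Real.pi * |x|) / L := norm_zOf_le hR1 x
      _ ≤ 8 * T / L := by
          refine div_le_div_of_nonneg_right ?_ (by linarith)
          nlinarith [Real.pi_lt_d2, Real.pi_pos]
      _ = 8 / T := by rw [← hT2]; field_simp
  -- the pointwise bound
  set bnd : ℝ → ℝ := fun x => (8 * (2 * C₁ + 8 * logSum w) / T) * phiWeight χ x +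
    (CA * (8 + C₂) / T) * (1 + ‖x‖) ^ (-(2 : ℝ)) with hbnd
  have hbnd0 : ∀ x, 0 ≤ bnd x := fun x => by
    simp only [hbnd]; unfold phiWeight; positivity
  have hpt : ∀ x : ℝ, ‖phiF χ x * mainFactor R w x - phiF χ x * aF x‖ ≤ bnd x := by
    intro x
    rw [← mul_sub, norm_mul]
    by_cases hx : |x| ≤ T
    · -- the main range
      have hz := hzT x hx
      have hz1 : ‖zOf R x‖ ≤ 1 := hz.trans (by rw [div_le_one hT0]; linarith)
      have hzC : C₁ * ‖zOf R x‖ ≤ 1 / 2 := by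
        calc C₁ * ‖zOf R x‖ ≤ C₁ * (8 / T) := mul_le_mul_of_nonneg_left hz hC₁0
          _ ≤ C₁ * (8 / C₀) := by gcongr
          _ ≤ 1 / 2 := by rw [hC₀]; rw [mul_div_assoc', div_le_iff₀ (by positivity)]; nlinarith
      have hzw : ‖zOf R x‖ * Real.log (w + 1) ≤ 1 := by
        calc ‖zOf R x‖ * Real.log (w + 1) ≤ 8 / T * Real.log (w + 1) := mul_le_mul_of_nonneg_right hz hlogw
          _ ≤ 1 := by
              rw [div_mul_eq_mul_div, div_le_one hT0]
              nlinarith [hRw, hC₀32]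
      have hzS : 4 * ‖zOf R x‖ * logSum w ≤ 1 := by
        calc 4 * ‖zOf R x‖ * logSum w ≤ 4 * (8 / T) * logSum w := by gcongr
          _ ≤ 1 := by
              rw [show 4 * (8 / T) * logSum w = 32 * logSum w / T by ring, div_le_one hT0]
              nlinarith [hRw, hC₀32]
      have hmain := norm_mainFactor_sub_aF_le hC₁0 hC₁ hR1 w x hz1 hzC hzw hzS
      calc ‖phiF χ x‖ * ‖mainFactor R w x - aF x‖
          ≤ ‖phiF χ x‖ * (‖aF x‖ * ‖zOf R x‖ * (2 * C₁ + 8 * logSum w)) :=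
            mul_le_mul_of_nonneg_left hmain (norm_nonneg _)
        _ ≤ ‖phiF χ x‖ * ((1 + 2 * Real.pi * |x|) * (8 / T) * (2 * C₁ + 8 * logSum w)) := by
            refine mul_le_mul_of_nonneg_left ?_ (norm_nonneg _)
            refine mul_le_mul_of_nonneg_right (mul_le_mul (norm_aF_le x) hz (norm_nonneg _) (by positivity)) (by positivity)
        _ = (8 * (2 * C₁ + 8 * logSum w) / T) * phiWeight χ x := by unfold phiWeight; ring
        _ ≤ bnd x := by
            simp only [hbnd]
            have : 0 ≤ (CA * (8 + C₂) / T) * (1 + ‖x‖) ^ (-(2 : ℝ)) := by positivity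
            linarith
    · -- the tail `|x| > T`
      push Not at hx
      have hy : T ≤ 1 + |x| := by linarith [abs_nonneg x]
      have hy0 : 0 < 1 + |x| := by positivity
      have hφx := hφA x
      have hFx := norm_mainFactor_le_crude hC₂ hR w x
      have haFx := norm_aF_le x
      -- `‖φ‖ (‖F̃‖ + ‖a‖) ≤ CA (L(L+C₂)+7)(1+|x|)/(1+|x|)^8`
      have h1 : ‖phiF χ x‖ * ‖mainFactor R w x - aF x‖ ≤
          CA * ((1 + |x|) ^ 8)⁻¹ * ((L * (L + C₂) + 7) * (1 + |x|)) := by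
        have hsub : ‖mainFactor R w x - aF x‖ ≤ (L * (L + C₂) + 7) * (1 + |x|) := by
          have hLL0 : 0 ≤ L * (L + C₂) := mul_nonneg (by linarith) (by linarith)
          calc ‖mainFactor R w x - aF x‖ ≤ ‖mainFactor R w x‖ + ‖aF x‖ := norm_sub_le _ _
            _ ≤ L * (L + C₂) + (1 + 2 * Real.pi * |x|) := add_le_add hFx haFx
            _ ≤ (L * (L + C₂) + 7) * (1 + |x|) := by
                nlinarith [Real.pi_lt_d2, Real.pi_pos, abs_nonneg x, mul_nonneg hLL0 (abs_nonneg x)]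
        exact mul_le_mul hφx hsub (norm_nonneg _) (by positivity)
      have h2 : CA * ((1 + |x|) ^ 8)⁻¹ * ((L * (L + C₂) + 7) * (1 + |x|)) ≤
          (CA * (8 + C₂) / T) * (1 + ‖x‖) ^ (-(2 : ℝ)) := by
        have eR : (1 + ‖x‖) ^ (-(2 : ℝ)) = ((1 + |x|)⁻¹) ^ 2 := by
          rw [Real.norm_eq_abs, Real.rpow_neg hy0.le, Real.rpow_two, inv_pow]
        rw [eR]
        exact tail_algebra hCA0 hC₂0 hL1 hT0 hT2 hy hy0
      calc ‖phiF χ x‖ * ‖mainFactor R w x - aF x‖ ≤ (CA * (8 + C₂) / T) * (1 + ‖x‖) ^ (-(2 : ℝ)) := h1.trans h2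
        _ ≤ bnd x := by
            simp only [hbnd]
            have : 0 ≤ (8 * (2 * C₁ + 8 * logSum w) / T) * phiWeight χ x := by unfold phiWeight; positivity
            linarith
  -- integrate the pointwise bound
  have hint_bnd : Integrable bnd := (hφWi.const_mul _).add (htaili.const_mul _)
  have hint_val : ∫ x, bnd x = (8 * (2 * C₁ + 8 * logSum w) / T) * I₁ + (CA * (8 + C₂) / T) * I₂ := by
    simp only [hbnd]
    rw [integral_add (hφWi.const_mul _) (htaili.const_mul _), integral_const_mul, integral_const_mul]
  have hval_le : (8 * (2 * C₁ + 8 * logSum w) / T) * I₁ + (CA * (8 + C₂) / T) * I₂ ≤ K₀ * (1 + logSum w) / T := by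
    rw [div_mul_eq_mul_div, div_mul_eq_mul_div, ← add_div, div_le_div_iff_of_pos_right hT0]
    have hA : 8 * (2 * C₁ + 8 * logSum w) ≤ 64 * (C₁ + 1) * (1 + logSum w) := by
      nlinarith [mul_nonneg hC₁0 hS0]
    have hB : 8 * (2 * C₁ + 8 * logSum w) * I₁ ≤ 64 * (C₁ + 1) * (1 + logSum w) * I₁ :=
      mul_le_mul_of_nonneg_right hA hI₁0
    have hC : CA * (8 + C₂) * I₂ ≤ CA * (8 + C₂) * I₂ * (1 + logSum w) :=
      le_mul_of_one_le_right (by positivity) (by linarith)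
    calc 8 * (2 * C₁ + 8 * logSum w) * I₁ + CA * (8 + C₂) * I₂
        ≤ 64 * (C₁ + 1) * (1 + logSum w) * I₁ + CA * (8 + C₂) * I₂ * (1 + logSum w) := add_le_add hB hC
      _ = K₀ * (1 + logSum w) := by rw [hK₀]; ring
  have hFi := integrable_phiF_mul_mainFactor hs hsupp hC₂ hR w
  have haFi : Integrable fun x => phiF χ x * aF x := by
    have := integrable_aF_mul_phiF hs hsupp
    exact this.congr (Filter.Eventually.of_forall fun x => by ring)
  refine ⟨?_, ?_⟩
  · rw [← integral_sub hFi haFi]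
    calc ‖∫ x, (phiF χ x * mainFactor R w x - phiF χ x * aF x)‖ ≤ ∫ x, bnd x :=
          norm_integral_le_of_norm_le hint_bnd (Filter.Eventually.of_forall hpt)
      _ ≤ K₀ * (1 + logSum w) / T := by rw [hint_val]; exact hval_le
      _ ≤ (K₀ + I₁) * (1 + logSum w) / T := by gcongr; linarith
  · have hpt2 : ∀ x, ‖phiF χ x * mainFactor R w x‖ ≤ phiWeight χ x + bnd x := by
      intro x
      have h1 : ‖phiF χ x * aF x‖ ≤ phiWeight χ x := by
        rw [norm_mul]; unfold phiWeight
        exact mul_le_mul_of_nonneg_left (norm_aF_le x) (norm_nonneg _)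
      have h2 := hpt x
      have h3 : ‖phiF χ x * mainFactor R w x‖ ≤
          ‖phiF χ x * aF x‖ + ‖phiF χ x * mainFactor R w x - phiF χ x * aF x‖ := by
        have e : phiF χ x * mainFactor R w x =
            phiF χ x * aF x + (phiF χ x * mainFactor R w x - phiF χ x * aF x) := by ring
        calc ‖phiF χ x * mainFactor R w x‖
            = ‖phiF χ x * aF x + (phiF χ x * mainFactor R w x - phiF χ x * aF x)‖ := by rw [← e]
          _ ≤ _ := norm_add_le _ _
      linarith
    have hST : 1 + logSum w ≤ T := by
      have : 1 + logSum w ≤ C₀ * (1 + Real.log (w + 1) + logSum w) := by nlinarith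
      exact this.trans hRw
    calc ∫ x, ‖phiF χ x * mainFactor R w x‖ ≤ ∫ x, (phiWeight χ x + bnd x) :=
          integral_mono hFi.norm (hφWi.add hint_bnd) hpt2
      _ = I₁ + ∫ x, bnd x := by rw [integral_add hφWi hint_bnd]
      _ ≤ I₁ + K₀ * (1 + logSum w) / T := by rw [hint_val]; exact add_le_add le_rfl hval_le
      _ ≤ I₁ + K₀ := by
          have : K₀ * (1 + logSum w) / T ≤ K₀ := by
            rw [div_le_iff₀ hT0]; exact mul_le_mul_of_nonneg_left hST hK₀0
          linarith
      _ = K₀ + I₁ := by ring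

end Literature.NumberTheory.Sieve.SharpGY

noncomputable section

open Finset Complex Filter Topology MeasureTheory
open scoped BigOperators

namespace Literature.NumberTheory.Sieve.SharpGY

open Literature.NumberTheory.Sieve.CFZ

/-! ### Powers: `‖a^n - b^n‖ ≤ n M^{n-1} ‖a - b‖` -/

/-- `‖a^n - b^n‖ ≤ n M^{n-1} ‖a - b‖` when `‖a‖, ‖b‖ ≤ M` (`a^n - b^n = (a-b) ∑_k a^k b^{n-1-k}`). [folklore] -/
theorem norm_pow_sub_pow_le (a b : ℂ) {M : ℝ} (ha : ‖a‖ ≤ M) (hb : ‖b‖ ≤ M) (n : ℕ) :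
    ‖a ^ n - b ^ n‖ ≤ n * M ^ (n - 1) * ‖a - b‖ := by
  have hM : 0 ≤ M := (norm_nonneg a).trans ha
  rw [← geom_sum₂_mul, norm_mul]
  refine mul_le_mul_of_nonneg_right ?_ (norm_nonneg _)
  calc ‖∑ i ∈ range n, a ^ i * b ^ (n - 1 - i)‖ ≤ ∑ i ∈ range n, ‖a ^ i * b ^ (n - 1 - i)‖ := norm_sum_le _ _
    _ ≤ ∑ _i ∈ range n, M ^ (n - 1) := by
        refine sum_le_sum fun i hi => ?_
        rw [mem_range] at hi
        rw [norm_mul, norm_pow, norm_pow]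
        calc ‖a‖ ^ i * ‖b‖ ^ (n - 1 - i) ≤ M ^ i * M ^ (n - 1 - i) :=
              mul_le_mul (pow_le_pow_left₀ (norm_nonneg _) ha i) (pow_le_pow_left₀ (norm_nonneg _) hb _)
                (by positivity) (by positivity)
          _ = M ^ (n - 1) := by rw [← pow_add]; congr 1; omega
    _ = n * M ^ (n - 1) := by rw [sum_const, card_range, nsmul_eq_mul]

variable {ι : Type*} [Fintype ι] {W : ℕ} (G : LocalCoeff ι W)

/-! ### From `∏_i ζ(1+z_i)^{-1}/∏_{p≤w} E'_p` to `∏_i F̃(η_i)` -/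

omit [Fintype ι] in
/-- `1 - p^{-1-z_i(η)} ≠ 0` for primes `p` and `R > 1`. [folklore] -/
theorem one_sub_cpow_zVec_ne_zero {R : ℝ} (hR : 1 < R) {p : ℕ} (hp : p.Prime) (η : ι → ℝ) (i : ι) :
    (1 : ℂ) - (p : ℂ) ^ (-(1 + zVec R η i)) ≠ 0 := by
  have hre : 0 ≤ (zVec R η i).re := (zVec_re_pos hR η i).le
  intro h
  have h1 : (p : ℂ) ^ (-(1 + zVec R η i)) = 1 := by linear_combination -h
  have hq := norm_natCast_cpow_neg_one_add_le hp.one_lt.le hre (z := zVec R η i)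
  rw [h1, norm_one] at hq
  have hp2 : (2 : ℝ) ≤ p := by exact_mod_cast hp.two_le
  have : (1 : ℝ) / p ≤ 1 / 2 := by rw [div_le_div_iff₀ (by linarith) two_pos]; linarith
  linarith

/-- **`log^{|ι|} R · (∏_i ζ(1+z_i)^{-1}) / ∏_{p≤w} E'_p = (W/φ(W))^{|ι|} ∏_i F̃(η_i)`** (regrouping the
Euler factors of the small primes form by form, `∏_{p≤w} E'_p = ∏_i ∏_{p≤w} (1 - p^{-1-z_i})`).
[cite: GreenTao2010, App. D, (D.13) and p. 1834] -/
theorem logpow_mul_main_eq (R : ℝ) (w : ℕ) (η : ι → ℝ) :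
    (Real.log R : ℂ) ^ Fintype.card ι *
        ((∏ i, (riemannZeta (1 + zVec R η i))⁻¹) / ∏ p ∈ (w + 1).primesBelow, eulerMain p (zVec R η)) =
      ((primorial w : ℂ) / Nat.totient (primorial w)) ^ Fintype.card ι * ∏ i, mainFactor R w (η i) := by
  have hW : (primorial w : ℂ) ≠ 0 := by exact_mod_cast (primorial_pos w).ne'
  have hφ : (Nat.totient (primorial w) : ℂ) ≠ 0 := by
    exact_mod_cast (Nat.totient_pos.2 (primorial_pos w)).ne'
  have hregroup : (∏ i, (riemannZeta (1 + zVec R η i))⁻¹) / ∏ p ∈ (w + 1).primesBelow, eulerMain p (zVec R η) =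
      ∏ i, ((riemannZeta (1 + zVec R η i))⁻¹ *
        (∏ p ∈ (w + 1).primesBelow, (1 - (p : ℂ) ^ (-(1 + zVec R η i))))⁻¹) := by
    unfold eulerMain
    rw [Finset.prod_comm, div_eq_mul_inv, ← Finset.prod_inv_distrib, ← Finset.prod_mul_distrib]
  rw [hregroup]
  have hfac : ∀ i, mainFactor R w (η i) = (Real.log R : ℂ) * ((Nat.totient (primorial w) : ℂ) / primorial w) *
      ((riemannZeta (1 + zVec R η i))⁻¹ *
        (∏ p ∈ (w + 1).primesBelow, (1 - (p : ℂ) ^ (-(1 + zVec R η i))))⁻¹) := by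
    intro i; unfold mainFactor zVec; ring
  have hfac' : ∏ i, mainFactor R w (η i) =
      ((Real.log R : ℂ) * ((Nat.totient (primorial w) : ℂ) / primorial w)) ^ Fintype.card ι *
        ∏ i, ((riemannZeta (1 + zVec R η i))⁻¹ *
          (∏ p ∈ (w + 1).primesBelow, (1 - (p : ℂ) ^ (-(1 + zVec R η i))))⁻¹) := by
    rw [Finset.prod_congr rfl fun i _ => hfac i, Finset.prod_mul_distrib, Finset.prod_const, card_univ]
  have key : (primorial w : ℂ) / Nat.totient (primorial w) * ((Nat.totient (primorial w) : ℂ) / primorial w) = 1 := by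
    field_simp
  rw [hfac', mul_pow, ← mul_assoc, ← mul_assoc, mul_comm (((primorial w : ℂ) / _) ^ _) ((Real.log R : ℂ) ^ _),
    mul_assoc ((Real.log R : ℂ) ^ _), ← mul_pow, key, one_pow, mul_one]

/-! ### The limit function and its measurability -/

/-- The pointwise limit `L(η) = (∏_i ζ(1+z_i)^{-1}/∏_{p≤w} E'_p) ∏'_q (1 + δ'_q)` of `∏_{p<Q} E_p(z(η))`.
[cite: GreenTao2010, App. D, (D.10)–(D.13), Prop. D.4] -/
def limitFn (R : ℝ) (w : ℕ) (η : ι → ℝ) : ℂ :=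
  ((∏ i, (riemannZeta (1 + zVec R η i))⁻¹) / ∏ p ∈ (w + 1).primesBelow, eulerMain p (zVec R η)) *
    ∏' q, (1 + deltaSeq G R w η q)

variable {χ : ℝ → ℝ} (hs : ContDiff ℝ (⊤ : ℕ∞) χ) (hsupp : ∀ x, 1 ≤ |x| → χ x = 0)
include hs hsupp

/-- `(∏_i φ(η_i)) L(η)` is (a.e. strongly) measurable, as the pointwise limit of the continuous
partial products. [folklore] -/
theorem aestronglyMeasurable_prod_phiF_mul_limitFn {R : ℝ} (hR : 1 < R) {w : ℕ}
    (hW : ∀ p : ℕ, p.Prime → (p ∣ W ↔ p ≤ w)) (hw : 2 * Fintype.card ι ≤ w) (hw1 : 1 ≤ w) :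
    AEStronglyMeasurable (fun η : ι → ℝ => (∏ i, phiF χ (η i)) * limitFn G R w η) (fullMeasure ι) := by
  have hφc : Continuous (phiF χ) := by rw [← phiS_coe hs hsupp]; exact (phiS hs hsupp).continuous
  have hΦc : Continuous fun η : ι → ℝ => ∏ i, phiF χ (η i) :=
    continuous_finsetProd _ fun i _ => hφc.comp (continuous_apply i)
  have hEc : ∀ p : ℕ, 0 < p → Continuous fun η : ι → ℝ => eulerFactor G p (zVec R η) := by
    intro p hp
    unfold eulerFactor
    refine continuous_finsetSum _ fun Y _ => continuous_const.mul (continuous_finsetProd _ fun i _ => ?_)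
    refine Continuous.neg (Continuous.const_cpow ?_ (Or.inl (by exact_mod_cast hp.ne')))
    exact ((continuous_zOf R).comp (continuous_apply i)).neg
  refine aestronglyMeasurable_of_tendsto_ae atTop
    (f := fun (Q : ℕ) (η : ι → ℝ) => (∏ i, phiF χ (η i)) * ∏ p ∈ Q.primesBelow, eulerFactor G p (zVec R η))
    (fun Q => ?_) (ae_of_all _ fun η => ?_)
  · refine (hΦc.mul ?_).aestronglyMeasurable
    exact continuous_finsetProd _ fun p hp => hEc p (Nat.mem_primesBelow.1 hp).2.pos
  · exact tendsto_const_nhds.mul (tendsto_prod_eulerFactor G R w η hR hW hw hw1)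

/-! ### The main term (Thm. D.3 with `a_i = 1`, the integral evaluated) -/

/-- **The main-term integral, evaluated** ((D.16)–(D.17) with `a_i = 1`): there are `K, C₀`
(depending on `χ` and `|ι|`) such that for `R ≥ e`, `p ∣ W ↔ p ≤ w`, `w ≥ max(2|ι|, 1)` and
`C₀ (1 + log(w+1) + S₁(w)) ≤ log^{1/2} R`,
`‖log^{|ι|} R ∫ (∏_i φ(η_i)) L(η) dη - (W/φ(W))^{|ι|} c^{|ι|}‖ ≤ (W/φ(W))^{|ι|} K ((1 + S₁(w)) log^{-1/2} R + (e^{4·2^{|ι|}/w} - 1))`,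
`c = -χ'(0) = c_{χ,1}` — the sieve factors `∏_i c_{χ_i,1}`, the local factors `∏_{p ≤ w} β_p = (W/φ(W))^{|ι|}`,
and `∏_{p > w} β_p = 1 + O(1/w)`. [cite: GreenTao2010, App. D, Thm. D.3 ((D.9)), Lemma D.2, (D.16)–(D.17), and p. 1834] -/
theorem exists_main_term_bound :
    ∃ K C₀ : ℝ, 0 ≤ K ∧ 1 ≤ C₀ ∧ ∀ (R : ℝ) (w : ℕ), Real.exp 1 ≤ R →
      (∀ p : ℕ, p.Prime → (p ∣ W ↔ p ≤ w)) → 2 * Fintype.card ι ≤ w → 1 ≤ w →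
      C₀ * (1 + Real.log (w + 1) + logSum w) ≤ Real.sqrt (Real.log R) →
        ‖(Real.log R : ℂ) ^ Fintype.card ι * ∫ η, (∏ i, phiF χ (η i)) * limitFn G R w η ∂(fullMeasure ι) -
            ((primorial w : ℂ) / Nat.totient (primorial w)) ^ Fintype.card ι *
              (-((deriv χ 0 : ℝ) : ℂ)) ^ Fintype.card ι‖ ≤
          ((primorial w : ℝ) / Nat.totient (primorial w)) ^ Fintype.card ι * K *
            ((1 + logSum w) / Real.sqrt (Real.log R) + (Real.exp (4 * 2 ^ Fintype.card ι / w) - 1)) := by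
  obtain ⟨K, C₀, hK0, hC₀1, hmain⟩ := exists_mainFactor_integral_bound hs hsupp
  obtain ⟨C₂, -, hC₂⟩ := exists_norm_inv_zeta_le
  set n : ℕ := Fintype.card ι with hn
  set c : ℂ := -((deriv χ 0 : ℝ) : ℂ) with hc
  set K' : ℝ := K + ‖c‖ + 1 with hK'
  have hK'1 : 1 ≤ K' := by rw [hK']; linarith [norm_nonneg c]
  refine ⟨(n + 1) * K' ^ (n + 1), C₀, by positivity, hC₀1, fun R w hR hW hw hw1 hRw => ?_⟩
  have hR1 : 1 < R := lt_of_lt_of_le (by have := Real.exp_one_gt_d9; linarith) hR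
  obtain ⟨hdiff, habs⟩ := hmain R w hR hRw
  have hS0 := logSum_nonneg w
  have hsqrt0 : 0 < Real.sqrt (Real.log R) := Real.sqrt_pos.2 (Real.log_pos hR1)
  -- notation
  set Wφ : ℂ := (primorial w : ℂ) / Nat.totient (primorial w) with hWφ
  set Wφr : ℝ := (primorial w : ℝ) / Nat.totient (primorial w) with hWφr
  have hWφn : ‖Wφ‖ = Wφr := by rw [hWφ, norm_div, Complex.norm_natCast, Complex.norm_natCast]
  have hWφr0 : 0 ≤ Wφr := by rw [hWφr]; positivity
  set F : (ι → ℝ) → ℂ := fun η => ∏ i, mainFactor R w (η i) with hF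
  set Φ : (ι → ℝ) → ℂ := fun η => ∏ i, phiF χ (η i) with hΦ
  set Pc : (ι → ℝ) → ℂ := fun η => ∏' q, (1 + deltaSeq G R w η q) with hPc
  set πw : ℝ := Real.exp (4 * 2 ^ n / (w : ℝ)) - 1 with hπw
  have hπw0 : 0 ≤ πw := by rw [hπw]; linarith [Real.add_one_le_exp (4 * 2 ^ n / (w : ℝ)), (by positivity : (0:ℝ) ≤ 4 * 2 ^ n / (w : ℝ))]
  have hPc1 : ∀ η, ‖Pc η - 1‖ ≤ πw := fun η =>
    (deltaSeq_summable_and_bounds G R w η hR1 hW hw hw1).2.2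
  -- the pointwise identity `log^n R · L(η) = Wφ^n F(η) Π(η)`
  have hpt : ∀ η, (Real.log R : ℂ) ^ n * limitFn G R w η = Wφ ^ n * (F η * Pc η) := by
    intro η
    unfold limitFn
    rw [← mul_assoc, logpow_mul_main_eq R w η]
    simp only [hF, hPc, hWφ]
    ring
  -- integrability of `Φ F` and the value of its integral
  have hone : Integrable (fun x => phiF χ x * mainFactor R w x) := integrable_phiF_mul_mainFactor hs hsupp hC₂ hR w
  have hΦF_eq : ∀ η, Φ η * F η = ∏ i, (phiF χ (η i) * mainFactor R w (η i)) := fun η => by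
    simp only [hΦ, hF, prod_mul_distrib]
  have hΦFi : Integrable (fun η => Φ η * F η) (fullMeasure ι) := by
    simp_rw [hΦF_eq]
    unfold fullMeasure
    exact Integrable.fintype_prod (f := fun _ x => phiF χ x * mainFactor R w x) fun _ => hone
  have hΦF_int : ∫ η, Φ η * F η ∂(fullMeasure ι) = (∫ x, phiF χ x * mainFactor R w x) ^ n := by
    simp_rw [hΦF_eq]
    unfold fullMeasure
    rw [integral_fintype_prod_eq_prod (f := fun _ x => phiF χ x * mainFactor R w x), prod_const, card_univ]
  have hΦF_abs : ∫ η, ‖Φ η * F η‖ ∂(fullMeasure ι) ≤ K ^ n := by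
    have e : ∀ η, ‖Φ η * F η‖ = ∏ i, ‖phiF χ (η i) * mainFactor R w (η i)‖ := fun η => by
      rw [hΦF_eq, norm_prod]
    simp_rw [e]
    unfold fullMeasure
    rw [integral_fintype_prod_eq_prod (f := fun _ x => ‖phiF χ x * mainFactor R w x‖), prod_const, card_univ]
    exact pow_le_pow_left₀ (integral_nonneg fun x => norm_nonneg _) habs n
  -- measurability of `Φ · L` and integrability of `Φ F (Π - 1)`
  have hmeas := aestronglyMeasurable_prod_phiF_mul_limitFn G hs hsupp hR1 hW hw hw1
  have hlogn : (Real.log R : ℂ) ^ n ≠ 0 := pow_ne_zero _ (by exact_mod_cast (Real.log_pos hR1).ne')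
  have hWφ0 : Wφ ≠ 0 := by
    rw [hWφ]; exact div_ne_zero (by exact_mod_cast (primorial_pos w).ne')
      (by exact_mod_cast (Nat.totient_pos.2 (primorial_pos w)).ne')
  have hΦFP_eq : ∀ η, Φ η * (F η * Pc η) = ((Real.log R : ℂ) ^ n / Wφ ^ n) * (Φ η * limitFn G R w η) := by
    intro η
    have h2 : F η * Pc η = (Real.log R : ℂ) ^ n * limitFn G R w η / Wφ ^ n := by
      rw [eq_div_iff (pow_ne_zero _ hWφ0), mul_comm]
      exact (hpt η).symm
    rw [h2]
    ring
  have hΦFP_meas : AEStronglyMeasurable (fun η => Φ η * (F η * Pc η)) (fullMeasure ι) := by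
    simp_rw [hΦFP_eq]
    exact hmeas.const_mul _
  have hcorr_i : Integrable (fun η => Φ η * F η * (Pc η - 1)) (fullMeasure ι) := by
    have hm : AEStronglyMeasurable (fun η => Φ η * F η * (Pc η - 1)) (fullMeasure ι) := by
      have : (fun η => Φ η * F η * (Pc η - 1)) = fun η => Φ η * (F η * Pc η) - Φ η * F η := by
        funext η; ring
      rw [this]
      exact hΦFP_meas.sub hΦFi.aestronglyMeasurable
    refine (hΦFi.norm.mul_const πw).mono' hm (ae_of_all _ fun η => ?_)
    rw [norm_mul]
    exact mul_le_mul_of_nonneg_left (hPc1 η) (norm_nonneg _)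
  -- the decomposition of the integral
  have hint_eq : (Real.log R : ℂ) ^ n * ∫ η, Φ η * limitFn G R w η ∂(fullMeasure ι) =
      Wφ ^ n * ((∫ η, Φ η * F η ∂(fullMeasure ι)) + ∫ η, Φ η * F η * (Pc η - 1) ∂(fullMeasure ι)) := by
    rw [← integral_const_mul, ← integral_add hΦFi hcorr_i, ← integral_const_mul]
    refine integral_congr_ae (ae_of_all _ fun η => ?_)
    show (Real.log R : ℂ) ^ n * (Φ η * limitFn G R w η) = Wφ ^ n * (Φ η * F η + Φ η * F η * (Pc η - 1))
    rw [mul_left_comm, hpt η]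
    ring
  -- the two error terms
  have hI := hΦF_int
  set J : ℂ := ∫ x, phiF χ x * mainFactor R w x with hJ
  have hJK : ‖J‖ ≤ K := (norm_integral_le_integral_norm _).trans habs
  have hJK' : ‖J‖ ≤ K' := by rw [hK']; linarith [norm_nonneg c]
  have hcK' : ‖c‖ ≤ K' := by rw [hK']; linarith
  have hKK' : K ≤ K' := by rw [hK']; linarith [norm_nonneg c]
  have hcJ : ‖J - c‖ ≤ K * (1 + logSum w) / Real.sqrt (Real.log R) := by
    rw [hJ, hc, ← integral_phiF_mul_aF hs hsupp]; exact hdiff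
  have herr1 : ‖J ^ n - c ^ n‖ ≤ n * K' ^ (n - 1) * (K * (1 + logSum w) / Real.sqrt (Real.log R)) :=
    (norm_pow_sub_pow_le J c hJK' hcK' n).trans (mul_le_mul_of_nonneg_left hcJ (by positivity))
  have herr2 : ‖∫ η, Φ η * F η * (Pc η - 1) ∂(fullMeasure ι)‖ ≤ K ^ n * πw := by
    calc ‖∫ η, Φ η * F η * (Pc η - 1) ∂(fullMeasure ι)‖ ≤ ∫ η, ‖Φ η * F η‖ * πw ∂(fullMeasure ι) :=
          norm_integral_le_of_norm_le (hΦFi.norm.mul_const πw) (ae_of_all _ fun η => by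
            rw [norm_mul]; exact mul_le_mul_of_nonneg_left (hPc1 η) (norm_nonneg _))
      _ = (∫ η, ‖Φ η * F η‖ ∂(fullMeasure ι)) * πw := integral_mul_const _ _
      _ ≤ K ^ n * πw := mul_le_mul_of_nonneg_right hΦF_abs hπw0
  -- assemble
  rw [hint_eq, hI, show Wφ ^ n * (J ^ n + ∫ η, Φ η * F η * (Pc η - 1) ∂(fullMeasure ι)) - Wφ ^ n * c ^ n =
    Wφ ^ n * ((J ^ n - c ^ n) + ∫ η, Φ η * F η * (Pc η - 1) ∂(fullMeasure ι)) by ring, norm_mul, norm_pow, hWφn]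
  have hinner : ‖(J ^ n - c ^ n) + ∫ η, Φ η * F η * (Pc η - 1) ∂(fullMeasure ι)‖ ≤
      (n + 1) * K' ^ (n + 1) * ((1 + logSum w) / Real.sqrt (Real.log R) + πw) := by
    have h1 : (n : ℝ) * K' ^ (n - 1) * K ≤ (n + 1) * K' ^ (n + 1) := by
      have hp : K' ^ (n - 1) * K ≤ K' ^ (n + 1) := by
        calc K' ^ (n - 1) * K ≤ K' ^ (n - 1) * K' := mul_le_mul_of_nonneg_left hKK' (by positivity)
          _ = K' ^ (n - 1 + 1) := by rw [pow_succ]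
          _ ≤ K' ^ (n + 1) := pow_le_pow_right₀ hK'1 (by omega)
      calc (n : ℝ) * K' ^ (n - 1) * K = n * (K' ^ (n - 1) * K) := by ring
        _ ≤ (n + 1) * K' ^ (n + 1) := mul_le_mul (by linarith) hp (by positivity) (by positivity)
    have h2 : K ^ n ≤ (n + 1) * K' ^ (n + 1) := by
      calc K ^ n ≤ K' ^ n := pow_le_pow_left₀ hK0 hKK' n
        _ ≤ K' ^ (n + 1) := pow_le_pow_right₀ hK'1 (by omega)
        _ ≤ (n + 1) * K' ^ (n + 1) := le_mul_of_one_le_left (by positivity) (by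
            have : (0:ℝ) ≤ n := Nat.cast_nonneg n; linarith)
    have hq : 0 ≤ (1 + logSum w) / Real.sqrt (Real.log R) := by positivity
    calc ‖(J ^ n - c ^ n) + ∫ η, Φ η * F η * (Pc η - 1) ∂(fullMeasure ι)‖
        ≤ ‖J ^ n - c ^ n‖ + ‖∫ η, Φ η * F η * (Pc η - 1) ∂(fullMeasure ι)‖ := norm_add_le _ _
      _ ≤ n * K' ^ (n - 1) * (K * (1 + logSum w) / Real.sqrt (Real.log R)) + K ^ n * πw := add_le_add herr1 herr2
      _ = (n * K' ^ (n - 1) * K) * ((1 + logSum w) / Real.sqrt (Real.log R)) + K ^ n * πw := by ring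
      _ ≤ (n + 1) * K' ^ (n + 1) * ((1 + logSum w) / Real.sqrt (Real.log R)) + (n + 1) * K' ^ (n + 1) * πw :=
          add_le_add (mul_le_mul_of_nonneg_right h1 hq) (mul_le_mul_of_nonneg_right h2 hπw0)
      _ = (n + 1) * K' ^ (n + 1) * ((1 + logSum w) / Real.sqrt (Real.log R) + πw) := by ring
  calc Wφr ^ n * ‖(J ^ n - c ^ n) + ∫ η, Φ η * F η * (Pc η - 1) ∂(fullMeasure ι)‖
      ≤ Wφr ^ n * ((n + 1) * K' ^ (n + 1) * ((1 + logSum w) / Real.sqrt (Real.log R) + πw)) :=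
        mul_le_mul_of_nonneg_left hinner (pow_nonneg hWφr0 n)
    _ = Wφr ^ n * ((n + 1) * K' ^ (n + 1)) * ((1 + logSum w) / Real.sqrt (Real.log R) + πw) := by ring

end Literature.NumberTheory.Sieve.SharpGY

/-! ## Part III — local factors of `W`-tricked systems and the correlation estimate (Thm. D.3, `a_i = 1`) -/

noncomputable section

open Finset
open scoped BigOperators

namespace Literature.NumberTheory.Sieve.SharpGY

open Literature.NumberTheory.Sieve.CFZ

variable {d t : ℕ}

/-! ### Two more facts on the local densities `α(p, S)` -/

/-- `α(p, S) ≤ 1`. [folklore] -/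
theorem primeDensity_le_one (Ψ : Fin t → AffLinForm d) (S : Finset (Fin t)) (p : ℕ) [NeZero p] :
    primeDensity Ψ S p ≤ 1 :=
  (primeDensity_mono Ψ (empty_subset S) p).trans (by rw [primeDensity_empty])

/-- **A form constant and non-zero modulo `p` is never divisible by `p`**: if some `ψ_i`, `i ∈ S`,
has all coefficients `≡ 0` and constant `≢ 0 (mod p)` then `α(p, S) = 0` (the primes `p ∣ W`
of a `W`-tricked system: "the exceptional primes are those dividing `W`").
[cite: GreenTao2010, App. D, p. 1834 ("`β_p = … ` for `p ≤ w`") and §5 (the `W`-trick)] -/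
theorem primeDensity_eq_zero_of_const {p : ℕ} [NeZero p] (Ψ : Fin t → AffLinForm d) {S : Finset (Fin t)}
    {i : Fin t} (hi : i ∈ S) (hcoeff : ∀ j, (((Ψ i).coeff j : ℤ) : ZMod p) = 0)
    (hconst : (((Ψ i).const : ℤ) : ZMod p) ≠ 0) : primeDensity Ψ S p = 0 := by
  unfold primeDensity
  refine Finset.expect_eq_zero fun v _ => prod_eq_zero hi ?_
  rw [if_neg]
  unfold AffLinForm.modEval
  rw [sum_eq_zero fun j _ => by rw [hcoeff j, zero_mul], zero_add]
  exact hconst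

/-- The local density as a total function of `p` (`1` at `p = 0`). [folklore] -/
def primeDensity₀ (Ψ : Fin t → AffLinForm d) (S : Finset (Fin t)) (p : ℕ) : ℝ :=
  if h : p = 0 then 1 else (haveI : NeZero p := ⟨h⟩; primeDensity Ψ S p)

/-- `primeDensity₀ = primeDensity` for `p ≠ 0`. [folklore] -/
theorem primeDensity₀_eq (Ψ : Fin t → AffLinForm d) (S : Finset (Fin t)) (p : ℕ) [NeZero p] :
    primeDensity₀ Ψ S p = primeDensity Ψ S p := by
  unfold primeDensity₀; rw [dif_neg (NeZero.ne p)]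

/-- `primeDensity₀ Ψ ∅ p = 1`. [folklore] -/
theorem primeDensity₀_empty (Ψ : Fin t → AffLinForm d) (p : ℕ) : primeDensity₀ Ψ ∅ p = 1 := by
  unfold primeDensity₀
  split_ifs with h
  · rfl
  · haveI : NeZero p := ⟨h⟩; exact primeDensity_empty Ψ p

/-! ### `W`-tricked systems and their local factors -/

/-- The `W`-tricked system `ψ_i(n) = W (L_i · n) + b` (all forms in the same residue class `b`
modulo `W`; for the Gowers cubes `L_ω = (1, 1_ω)`, `ψ_ω(x, h) = W(x + ω·h) + b`).
[cite: GreenTao2010, §12, (12.6) and §5 (`Λ_{b,W}`)] -/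
def wtrickSys (W : ℕ) (L : Fin t → Fin d → ℤ) (b : ℤ) : Fin t → AffLinForm d :=
  fun i => ⟨fun j => (W : ℤ) * L i j, b⟩

/-- `ψ_i(n) = W ∑_j L_{ij} n_j + b`. [folklore] -/
theorem wtrickSys_eval (W : ℕ) (L : Fin t → Fin d → ℤ) (b : ℤ) (i : Fin t) (n : Fin d → ℤ) :
    (wtrickSys W L b i).eval n = W * ∑ j, L i j * n j + b := by
  simp [wtrickSys, AffLinForm.eval, mul_sum, mul_assoc]

/-- **No exceptional primes** for the un-tricked linear parts: every `L_i` has an entry `1`, and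
every pair `L_i, L_{i'}` has a unimodular `2 × 2` minor (true for the cube system
`L_ω = (1, 1_ω)`). [cite: GreenTao2010, App. D, proof of Thm. D.3 ("For `p ∉ P_Ψ` … `α(p,B) = O(1/p²)`
whenever `B` is not vertical or empty")] -/
structure GoodSystem (L : Fin t → Fin d → ℤ) : Prop where
  unit : ∀ i, ∃ j, L i j = 1
  minor : ∀ i i', i ≠ i' → ∃ j₀ j₁,
    L i j₀ * L i' j₁ - L i j₁ * L i' j₀ = 1 ∨ L i j₀ * L i' j₁ - L i j₁ * L i' j₀ = -1

/-- **The local factors of a `W`-tricked good system satisfy the `LocalCoeff` hypotheses**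
(`α(p,∅) = 1`; `α(p,B) = 0` for `p ∣ W`, `B ≠ ∅` since `ψ_i ≡ b ≢ 0 (mod p)`; `α(p,{i}) = 1/p` and
`α(p,B) ≤ 1/p²` for `|B| ≥ 2` when `p ∤ W`). [cite: GreenTao2010, App. D, proof of Thm. D.3 and p. 1834] -/
def wtrickCoeff (W : ℕ) (L : Fin t → Fin d → ℤ) (b : ℤ) (hL : GoodSystem L) (hb : IsCoprime b W) :
    LocalCoeff (Fin t) W where
  g p Y := if p.Prime then primeDensity₀ (wtrickSys W L b) Y p else if Y = ∅ then 1 else 0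
  g_empty p := by
    split_ifs with hp h
    · exact primeDensity₀_empty _ p
    · rfl
    · exact absurd rfl h
  g_nonneg p Y := by
    split_ifs with hp h
    · haveI : NeZero p := ⟨hp.ne_zero⟩
      rw [primeDensity₀_eq]; exact primeDensity_nonneg _ _ _
    · exact zero_le_one
    · exact le_rfl
  g_le_one p Y := by
    split_ifs with hp h
    · haveI : NeZero p := ⟨hp.ne_zero⟩
      rw [primeDensity₀_eq]; exact primeDensity_le_one _ _ _
    · exact le_rfl
    · exact zero_le_one
  g_dvd p hp hpW Y hY := by
    rw [if_pos hp]
    haveI : NeZero p := ⟨hp.ne_zero⟩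
    rw [primeDensity₀_eq]
    obtain ⟨i, hi⟩ := hY
    refine primeDensity_eq_zero_of_const _ hi (fun j => ?_) ?_
    · show (((W : ℤ) * L i j : ℤ) : ZMod p) = 0
      push_cast
      rw [(ZMod.natCast_eq_zero_iff W p).2 hpW, zero_mul]
    · show ((b : ℤ) : ZMod p) ≠ 0
      intro hb0
      rw [ZMod.intCast_zmod_eq_zero_iff_dvd] at hb0
      have hpW' : (p : ℤ) ∣ (W : ℤ) := Int.natCast_dvd_natCast.2 hpW
      have h1 : (p : ℤ) ∣ 1 := by
        obtain ⟨u, v, huv⟩ := hb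
        rw [← huv]; exact dvd_add (dvd_mul_of_dvd_right hb0 _) (dvd_mul_of_dvd_right hpW' _)
      have : (p : ℤ) ≤ 1 := Int.le_of_dvd one_pos h1
      have : (2 : ℤ) ≤ p := by exact_mod_cast hp.two_le
      omega
  g_singleton p hp hpW i := by
    rw [if_pos hp]
    haveI : NeZero p := ⟨hp.ne_zero⟩
    haveI : Fact p.Prime := ⟨hp⟩
    rw [primeDensity₀_eq]
    refine primeDensity_singleton _ i ?_
    obtain ⟨j, hj⟩ := hL.unit i
    intro h0
    have := congrFun h0 j
    simp only [wtrickSys, Pi.zero_apply, hj, mul_one] at this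
    exact hpW ((ZMod.intCast_zmod_eq_zero_iff_dvd _ p).1 this |> Int.natCast_dvd_natCast.1)
  g_two p hp hpW Y hY := by
    rw [if_pos hp]
    haveI : NeZero p := ⟨hp.ne_zero⟩
    haveI : Fact p.Prime := ⟨hp⟩
    rw [primeDensity₀_eq]
    obtain ⟨i, hi, i', hi', hii'⟩ := one_lt_card.1 (by omega : 1 < Y.card)
    obtain ⟨j₀, j₁, hM⟩ := hL.minor i i' hii'
    refine primeDensity_le_of_minor _ hi hi' j₀ j₁ ?_
    show ((((W : ℤ) * L i j₀) * ((W : ℤ) * L i' j₁) - ((W : ℤ) * L i j₁) * ((W : ℤ) * L i' j₀) : ℤ) : ZMod p) ≠ 0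
    have hW : (W : ZMod p) ≠ 0 := fun h => hpW ((ZMod.natCast_eq_zero_iff W p).1 h)
    have e : ((((W : ℤ) * L i j₀) * ((W : ℤ) * L i' j₁) - ((W : ℤ) * L i j₁) * ((W : ℤ) * L i' j₀) : ℤ) : ZMod p) =
        (W : ZMod p) ^ 2 * (((L i j₀ * L i' j₁ - L i j₁ * L i' j₀ : ℤ)) : ZMod p) := by
      push_cast; ring
    rw [e]
    refine mul_ne_zero (pow_ne_zero 2 hW) ?_
    rcases hM with h | h <;> rw [h] <;> simp

/-! ### The divisibility weight of a square-free tuple through the Chinese remainder theorem -/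

section crt

variable (Ψ : Fin t → AffLinForm d)

/-- The local weight at a prime: `f_p(u) = ∏_{i : p ∣ e_i} 1_{ψ_i(u) ≡ 0 (mod p)}`.
[cite: GreenTao2010, App. D, proof of Thm. D.3 (`α(p, B)`)] -/
def locWt (e : Fin t → ℕ) (p : ℕ) (u : Fin d → ZMod p) : ℝ :=
  ∏ i ∈ pattern e p, if (Ψ i).modEval p u = 0 then (1 : ℝ) else 0

/-- `𝔼_u f_p(u) = α(p, X_p(e))`. [folklore] -/
theorem expect_locWt (e : Fin t → ℕ) (p : ℕ) [NeZero p] :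
    𝔼 u : Fin d → ZMod p, locWt Ψ e p u = primeDensity Ψ (pattern e p) p := rfl

/-- `0 ≤ f_p ≤ 1`. [folklore] -/
theorem locWt_nonneg_le_one (e : Fin t → ℕ) (p : ℕ) (u : Fin d → ZMod p) :
    0 ≤ locWt Ψ e p u ∧ locWt Ψ e p u ≤ 1 :=
  ⟨prod_nonneg fun i _ => by split_ifs <;> norm_num,
    prod_le_one (fun i _ => by split_ifs <;> norm_num) fun i _ => by split_ifs <;> norm_num⟩

/-- The weight on `ℤ_D^d`, `D` square-free: `G(y) = ∏_{p ∣ D} f_p(y mod p)`.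
[cite: GreenTao2010, App. D, proof of Thm. D.3 ("`α_{m_1,…,m_t}` is multiplicative")] -/
def crtWt (e : Fin t → ℕ) {D : ℕ} (hD : Squarefree D) (y : Fin d → ZMod D) : ℝ :=
  ∏ p : D.primeFactors, locWt Ψ e p (fun j => crtSquarefree hD (y j) p)

/-- `|G| ≤ 1`. [folklore] -/
theorem abs_crtWt_le (e : Fin t → ℕ) {D : ℕ} (hD : Squarefree D) (y : Fin d → ZMod D) :
    |crtWt Ψ e hD y| ≤ 1 := by
  unfold crtWt
  have h0 : ∀ p : D.primeFactors, 0 ≤ locWt Ψ e p (fun j => crtSquarefree hD (y j) p) ∧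
      locWt Ψ e p (fun j => crtSquarefree hD (y j) p) ≤ 1 := fun p => locWt_nonneg_le_one _ _ _ _
  rw [abs_of_nonneg (prod_nonneg fun p _ => (h0 p).1)]
  exact prod_le_one (fun p _ => (h0 p).1) fun p _ => (h0 p).2

/-- **`𝔼_{ℤ_D^d} G = ∏_{p ∣ D} α(p, X_p(e))`** (independence of the local coordinates).
[cite: GreenTao2010, App. D, proof of Thm. D.3 (`α_{m_1,…,m_t} = ∏_p α_{p^{r_1},…}`)] -/
theorem expect_crtWt (e : Fin t → ℕ) {D : ℕ} (hD : Squarefree D) :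
    haveI : NeZero D := ⟨hD.ne_zero⟩
    𝔼 y : Fin d → ZMod D, crtWt Ψ e hD y =
      ∏ p : D.primeFactors, (haveI := CFZ.neZero_coe_primeFactors p; primeDensity Ψ (pattern e p) p) := by
  have h := expect_prod_crt hD (t := d) fun p u => locWt Ψ e p u
  unfold crtWt
  rw [h]
  exact Fintype.prod_congr _ _ fun p => rfl

/-- **`G(n mod D) = ∏_i 1_{e_i ∣ ψ_i(n)}`** at integer points, for square-free `e_i` with prime
factors dividing `D` (`e ∣ m ↔ p ∣ m ∀ p ∣ e`). [cite: GreenTao2010, App. D, proof of Thm. D.3] -/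
theorem crtWt_intCast (e : Fin t → ℕ) {D : ℕ} (hD : Squarefree D) (hsq : ∀ i, Squarefree (e i))
    (hsub : ∀ i, (e i).primeFactors ⊆ D.primeFactors) (n : Fin d → ℤ) :
    crtWt Ψ e hD (fun j => ((n j : ℤ) : ZMod D)) =
      ∏ i, if ((e i : ℕ) : ℤ) ∣ (Ψ i).eval n then (1 : ℝ) else 0 := by
  classical
  -- the `p`-component of the CRT map is a ring homomorphism
  set π : ∀ p : D.primeFactors, ZMod D →+* ZMod (p : ℕ) := fun p =>
    (Pi.evalRingHom (fun q : D.primeFactors => ZMod (q : ℕ)) p).comp (crtSquarefree hD).toRingHom with hπ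
  have hloc : ∀ (p : D.primeFactors) (i : Fin t),
      ((Ψ i).modEval p (fun j => crtSquarefree hD ((n j : ℤ) : ZMod D) p) = 0 ↔
        ((p : ℕ) : ℤ) ∣ (Ψ i).eval n) := by
    intro p i
    have hl : (fun j => crtSquarefree hD ((n j : ℤ) : ZMod D) p) = fun j => ((n j : ℤ) : ZMod (p : ℕ)) :=
      funext fun j => (map_intCast (π p) (n j) : _)
    rw [hl, ← AffLinForm.intCast_eval, ZMod.intCast_zmod_eq_zero_iff_dvd]
  unfold crtWt locWt
  by_cases H : ∀ i, ((e i : ℕ) : ℤ) ∣ (Ψ i).eval n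
  · rw [prod_eq_one fun i _ => if_pos (H i)]
    refine prod_eq_one fun p _ => prod_eq_one fun i hi => ?_
    rw [if_pos]
    rw [hloc]
    have hpd : (p : ℕ) ∣ e i := by simpa [pattern] using hi
    exact (Int.natCast_dvd_natCast.2 hpd).trans (H i)
  · push Not at H
    obtain ⟨i, hi⟩ := H
    rw [prod_eq_zero (mem_univ i) (if_neg hi)]
    rw [CFZ.squarefree_dvd_iff (hsq i)] at hi
    push Not at hi
    obtain ⟨p, hp, hpi⟩ := hi
    have hpD : p ∈ D.primeFactors := hsub i hp
    refine prod_eq_zero (mem_univ ⟨p, hpD⟩) (prod_eq_zero (i := i) ?_ ?_)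
    · simpa [pattern] using Nat.dvd_of_mem_primeFactors hp
    · rw [if_neg]
      rw [hloc ⟨p, hpD⟩ i]
      exact hpi

end crt

/-! ### The volume packing count of simultaneous divisibility over a convex body -/

open Classical MeasureTheory in
/-- **The count of `n ∈ K ∩ ℤ^d` with `e_i ∣ ψ_i(n)` for all `i`** (volume packing and CRT):
for square-free `e_i` with prime factors in a finite set of primes `P` and a convex body
`K ⊆ [-N,N]^d`,
`∑_{n ∈ K ∩ ℤ^d} ∏_i 1_{e_i ∣ ψ_i(n)} = vol(K) ∏_{p ∈ P} α(p, X_p(e)) + O_d(E (N + 2E)^{d-1})`, `E = ∏ e_i`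
(the paper's error `O(N^{d-1+O(γ)})`). [cite: GreenTao2010, App. D, proof of Thm. D.3 (the two displays after (D.9))] -/
theorem exists_sum_dvd_indicator_bound (hd : 1 ≤ d) : ∃ C : ℝ, 0 ≤ C ∧ ∀ N : ℕ, 1 ≤ N →
    ∀ K : Set (Fin d → ℝ), Convex ℝ K → K ⊆ realBox d N →
      ∀ (Ψ : Fin t → AffLinForm d) {P : Finset ℕ}, (∀ p ∈ P, p.Prime) →
        ∀ e : Fin t → ℕ, (∀ i, e i ∈ squarefreeOf P) →
          |(∑ n ∈ (latticeBox d N).filter (fun n => realPoint n ∈ K),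
              ∏ i, if ((e i : ℕ) : ℤ) ∣ (Ψ i).eval n then (1 : ℝ) else 0) -
              (volume K).toReal * ∏ p ∈ P, primeDensity₀ Ψ (pattern e p) p| ≤
            C * (∏ i, (e i : ℝ)) * ((N : ℝ) + 2 * ∏ i, (e i : ℝ)) ^ (d - 1) := by
  obtain ⟨C, hC0, hC⟩ := sum_periodic_weight (d := d) hd
  refine ⟨C, hC0, fun N hN K hK hKN Ψ P hP e he => ?_⟩
  -- the period
  set D : ℕ := tuplePeriod e (fun _ => 1) with hDdef
  have hD : Squarefree D := squarefree_tuplePeriod e _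
  haveI : NeZero D := ⟨hD.ne_zero⟩
  have hsq : ∀ i, Squarefree (e i) := fun i => ((mem_squarefreeOf hP).1 (he i)).1
  have hone : ∀ _i : Fin t, (1 : ℕ) ∈ squarefreeOf P := fun _ =>
    mem_image.2 ⟨∅, empty_mem_powerset _, by simp⟩
  have hsub : ∀ i, (e i).primeFactors ⊆ D.primeFactors := fun i => by
    rw [hDdef, primeFactors_tuplePeriod]; exact primeFactors_subset_tuplePrimes_left e _ i
  have hDP : D.primeFactors ⊆ P := by
    rw [hDdef, primeFactors_tuplePeriod]; exact tuplePrimes_subset hP he hone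
  -- volume packing with the weight `G`
  have h := hC N hN K hK hKN D (crtWt Ψ e hD) 1 (abs_crtWt_le Ψ e hD)
  have hsum : (∑ n ∈ (latticeBox d N).filter (fun n => realPoint n ∈ K),
      crtWt Ψ e hD (fun j => ((n j : ℤ) : ZMod D))) =
      ∑ n ∈ (latticeBox d N).filter (fun n => realPoint n ∈ K),
        ∏ i, if ((e i : ℕ) : ℤ) ∣ (Ψ i).eval n then (1 : ℝ) else 0 :=
    sum_congr rfl fun n _ => crtWt_intCast Ψ e hD hsq hsub n
  rw [hsum, expect_crtWt Ψ e hD] at h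
  -- the product over `D.primeFactors` is the product over `P`
  have hprod : (∏ p : D.primeFactors, (haveI := CFZ.neZero_coe_primeFactors p; primeDensity Ψ (pattern e p) p)) =
      ∏ p ∈ P, primeDensity₀ Ψ (pattern e p) p := by
    have e1 : (∏ p : D.primeFactors, (haveI := CFZ.neZero_coe_primeFactors p; primeDensity Ψ (pattern e p) p)) =
        ∏ p : D.primeFactors, primeDensity₀ Ψ (pattern e p) p :=
      Fintype.prod_congr _ _ fun p => by
        haveI := CFZ.neZero_coe_primeFactors p
        rw [primeDensity₀_eq]
    rw [e1, prod_coe_sort D.primeFactors (f := fun p => primeDensity₀ Ψ (pattern e p) p), ← prod_subset hDP]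
    intro p hpP hpD
    have hpat : pattern e p = ∅ := by
      ext i
      simp only [notMem_empty, iff_false]
      intro hi
      have hpd : p ∣ e i := by simpa [pattern] using hi
      exact hpD (hsub i (Nat.mem_primeFactors.2 ⟨hP p hpP, hpd, (hsq i).ne_zero⟩))
    rw [hpat, primeDensity₀_empty]
  rw [hprod, mul_one] at h
  -- the error term: `D^d (N/D + 2)^{d-1} = D (N + 2D)^{d-1} ≤ E (N + 2E)^{d-1}`
  have hD0 : (0 : ℝ) < D := by exact_mod_cast Nat.pos_of_ne_zero hD.ne_zero
  have hE0 : ∀ i, e i ≠ 0 := fun i => (hsq i).ne_zero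
  have hDE : (D : ℝ) ≤ ∏ i, (e i : ℝ) := by
    have hdvd : D ∣ ∏ i, e i := by
      rw [hDdef]
      unfold tuplePeriod
      refine Finset.prod_primes_dvd _ (fun p hp => Nat.prime_iff.1 (prime_of_mem_tuplePrimes hp)) fun p hp => ?_
      simp only [tuplePrimes, mem_biUnion, mem_univ, true_and, mem_union, Nat.primeFactors_one,
        notMem_empty, or_false] at hp
      obtain ⟨i, hi⟩ := hp
      exact (Nat.dvd_of_mem_primeFactors hi).trans (dvd_prod_of_mem _ (mem_univ i))
    have hpos : 0 < ∏ i, e i := prod_pos fun i _ => Nat.pos_of_ne_zero (hE0 i)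
    have := Nat.le_of_dvd hpos hdvd
    exact_mod_cast this
  have herr : (D : ℝ) ^ d * ((N : ℝ) / D + 2) ^ (d - 1) = D * ((N : ℝ) + 2 * D) ^ (d - 1) := by
    obtain ⟨m, hm⟩ : ∃ m, d = m + 1 := ⟨d - 1, by omega⟩
    rw [hm, Nat.add_sub_cancel, pow_succ]
    have hx : (D : ℝ) * ((N : ℝ) / D + 2) = N + 2 * D := by field_simp
    calc (D : ℝ) ^ m * D * ((N : ℝ) / D + 2) ^ m = D * ((D : ℝ) * ((N : ℝ) / D + 2)) ^ m := by
          rw [mul_pow]; ring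
      _ = D * ((N : ℝ) + 2 * D) ^ m := by rw [hx]
  have h' : C * (D : ℝ) ^ d * ((N : ℝ) / D + 2) ^ (d - 1) = C * ((D : ℝ) * ((N : ℝ) + 2 * D) ^ (d - 1)) := by
    rw [mul_assoc, herr]
  refine (h.trans (le_of_eq h')).trans ?_
  have hE := (hD0.le.trans hDE)
  calc C * ((D : ℝ) * ((N : ℝ) + 2 * D) ^ (d - 1))
      ≤ C * ((∏ i, (e i : ℝ)) * ((N : ℝ) + 2 * ∏ i, (e i : ℝ)) ^ (d - 1)) := by
        refine mul_le_mul_of_nonneg_left ?_ hC0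
        refine mul_le_mul hDE (pow_le_pow_left₀ (by positivity) (by linarith) _) (by positivity) hE
    _ = C * (∏ i, (e i : ℝ)) * ((N : ℝ) + 2 * ∏ i, (e i : ℝ)) ^ (d - 1) := by ring

end Literature.NumberTheory.Sieve.SharpGY

noncomputable section

open Finset
open scoped BigOperators

namespace Literature.NumberTheory.Sieve.SharpGY

open Literature.NumberTheory.Sieve.CFZ

variable {d t : ℕ}

/-! ### Expanding the product of truncated divisor sums (`a_i = 1`) -/

/-- `∑_{e ∣ m, e ≤ R} μ(e)χ(log e/log R) = ∑_{e ≤ R} μ(e)χ(log e/log R) 1_{e ∣ m}`. [folklore] -/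
theorem moebiusDivisorSum_eq_sum_ite (χ : ℝ → ℝ) (R : ℝ) (m : ℤ) :
    moebiusDivisorSum χ R m =
      ∑ e ∈ Icc 1 ⌊R⌋₊, moebiusWeight χ R e * (if ((e : ℕ) : ℤ) ∣ m then (1 : ℝ) else 0) := by
  unfold moebiusDivisorSum moebiusWeight
  rw [sum_filter]
  refine sum_congr rfl fun e _ => ?_
  split_ifs <;> simp

/-- **Expansion with `a_i = 1`**:
`∑_{n ∈ A} ∏_i Λ_{χ,R,1}(ψ_i(n)) = log^t R ∑_{e ∈ [1,R]^t} (∏_i μ(e_i)χ(log e_i/log R)) ∑_{n ∈ A} ∏_i 1_{e_i ∣ ψ_i(n)}`.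
[cite: GreenTao2010, App. D, proof of Thm. D.3 (first two displays), with `a_i = 1`] -/
theorem sum_prod_truncDivisorSum_one_eq (A : Finset (Fin d → ℤ)) (Ψ : Fin t → AffLinForm d)
    (χ : ℝ → ℝ) (R : ℝ) :
    ∑ n ∈ A, ∏ i, truncDivisorSum χ R 1 ((Ψ i).eval n) =
      Real.log R ^ t * ∑ e ∈ Fintype.piFinset (fun _ : Fin t => Icc 1 ⌊R⌋₊),
        (∏ i, moebiusWeight χ R (e i)) *
          ∑ n ∈ A, ∏ i, if ((e i : ℕ) : ℤ) ∣ (Ψ i).eval n then (1 : ℝ) else 0 := by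
  have hpt : ∀ n : Fin d → ℤ, ∏ i, truncDivisorSum χ R 1 ((Ψ i).eval n) =
      Real.log R ^ t * ∑ e ∈ Fintype.piFinset (fun _ : Fin t => Icc 1 ⌊R⌋₊),
        (∏ i, moebiusWeight χ R (e i)) * ∏ i, if ((e i : ℕ) : ℤ) ∣ (Ψ i).eval n then (1 : ℝ) else 0 := by
    intro n
    unfold truncDivisorSum
    simp_rw [pow_one, moebiusDivisorSum_eq_sum_ite]
    rw [prod_mul_distrib, prod_const, card_univ, Fintype.card_fin, prod_univ_sum]
    congr 1
    exact sum_congr rfl fun e _ => prod_mul_distrib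
  simp_rw [hpt]
  rw [← mul_sum, sum_comm]
  congr 1
  exact sum_congr rfl fun e _ => by rw [mul_sum]

/-! ### The main coefficient sum, re-indexed by square-free tuples -/

/-- The bound `|μ(e)χ(x)| ≤ B` for `|χ| ≤ B`. [folklore] -/
theorem abs_moebiusWeight_le {χ : ℝ → ℝ} {B : ℝ} (hB : ∀ x, |χ x| ≤ B) (R : ℝ) (e : ℕ) :
    |moebiusWeight χ R e| ≤ B := by
  unfold moebiusWeight
  rw [abs_mul]
  have hμ : |(ArithmeticFunction.moebius e : ℝ)| ≤ 1 := by exact_mod_cast ArithmeticFunction.abs_moebius_le_one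
  calc |(ArithmeticFunction.moebius e : ℝ)| * |χ (Real.log e / Real.log R)| ≤ 1 * B :=
        mul_le_mul hμ (hB _) (abs_nonneg _) zero_le_one
    _ = B := one_mul B

/-- `μ(e)χ(log e/log R) = 0` unless `e` is square-free. [folklore] -/
theorem moebiusWeight_eq_zero_of_not_squarefree (χ : ℝ → ℝ) (R : ℝ) {e : ℕ} (he : ¬Squarefree e) :
    moebiusWeight χ R e = 0 := by
  unfold moebiusWeight
  rw [ArithmeticFunction.moebius_eq_zero_of_not_squarefree he]
  simp

/-- `μ(e)χ(log e/log R) = 0` for `e ≥ R > 1` when `χ = 0` on `|x| ≥ 1`. [folklore] -/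
theorem moebiusWeight_eq_zero_of_le {χ : ℝ → ℝ} (hsupp : ∀ x, 1 ≤ |x| → χ x = 0) {R : ℝ} (hR : 1 < R)
    {e : ℕ} (he : R ≤ e) : moebiusWeight χ R e = 0 := by
  unfold moebiusWeight
  rw [hsupp _ ?_, mul_zero]
  have hlogR := Real.log_pos hR
  rw [abs_of_nonneg (div_nonneg (Real.log_nonneg (by linarith)) hlogR.le), le_div_iff₀ hlogR, one_mul]
  exact Real.log_le_log (by linarith) he

/-- A square-free `e ≤ R < Q` has all prime factors `< Q`: `e ∈ squarefreeOf (primes < Q)`. [folklore] -/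
theorem mem_squarefreeOf_primesBelow {e Q : ℕ} (hsq : Squarefree e) (heQ : e < Q) :
    e ∈ squarefreeOf Q.primesBelow := by
  rw [mem_squarefreeOf fun p hp => (Nat.mem_primesBelow.1 hp).2]
  refine ⟨hsq, fun p hp => ?_⟩
  rw [Nat.mem_primesBelow]
  exact ⟨lt_of_le_of_lt (Nat.le_of_mem_primeFactors hp) heQ, Nat.prime_of_mem_primeFactors hp⟩

/-- **Re-indexing by square-free tuples** (general form): if `F(e) = 0` whenever some `e_i` is not
square-free or some `e_i ≥ R`, then `∑_{e ∈ [1,R]^t} F(e) = ∑_{e ∈ SF(primes<Q)^t} F(e)` for `Q > R > 1`.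
[cite: GreenTao2010, App. D, proof of Thm. D.3] -/
theorem sum_box_eq_sum_squarefree_of {M : Type*} [AddCommMonoid M] {R : ℝ} (hR : 1 < R) {Q : ℕ}
    (hQ : R < Q) (F : (Fin t → ℕ) → M) (h1 : ∀ e i, ¬Squarefree (e i) → F e = 0)
    (h2 : ∀ e i, R ≤ e i → F e = 0) :
    ∑ e ∈ Fintype.piFinset (fun _ : Fin t => Icc 1 ⌊R⌋₊), F e =
      ∑ e ∈ Fintype.piFinset (fun _ : Fin t => squarefreeOf Q.primesBelow), F e := by
  classical
  have hP : ∀ p ∈ Q.primesBelow, p.Prime := fun p hp => (Nat.mem_primesBelow.1 hp).2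
  have hL : ∑ e ∈ Fintype.piFinset (fun _ : Fin t => Icc 1 ⌊R⌋₊), F e =
      ∑ e ∈ (Fintype.piFinset (fun _ : Fin t => Icc 1 ⌊R⌋₊)).filter
        (fun e => ∀ i, e i ∈ squarefreeOf Q.primesBelow), F e := by
    rw [sum_filter_of_ne]
    intro e he hne
    by_contra hnot
    push Not at hnot
    obtain ⟨i, hi⟩ := hnot
    have hei := Fintype.mem_piFinset.1 he i
    rw [mem_Icc] at hei
    have hsq : ¬Squarefree (e i) := fun hsq => hi (mem_squarefreeOf_primesBelow hsq (by
      have : (e i : ℝ) ≤ R := le_trans (by exact_mod_cast hei.2) (Nat.floor_le (by linarith))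
      exact_mod_cast lt_of_le_of_lt this hQ))
    exact hne (h1 e i hsq)
  have hR' : ∑ e ∈ Fintype.piFinset (fun _ : Fin t => squarefreeOf Q.primesBelow), F e =
      ∑ e ∈ (Fintype.piFinset (fun _ : Fin t => squarefreeOf Q.primesBelow)).filter
        (fun e => ∀ i, e i ∈ Icc 1 ⌊R⌋₊), F e := by
    rw [sum_filter_of_ne]
    intro e he hne
    by_contra hnot
    push Not at hnot
    obtain ⟨i, hi⟩ := hnot
    have hei := (mem_squarefreeOf hP).1 (Fintype.mem_piFinset.1 he i)
    have h1' : 1 ≤ e i := Nat.pos_of_ne_zero hei.1.ne_zero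
    rw [mem_Icc, not_and_or] at hi
    rcases hi with hi | hi
    · exact hi h1'
    · push Not at hi
      have hRe : R ≤ e i := by
        have := Nat.lt_floor_add_one R
        have h3 : (⌊R⌋₊ + 1 : ℕ) ≤ e i := hi
        calc R ≤ (⌊R⌋₊ + 1 : ℕ) := by push_cast; linarith
          _ ≤ e i := by exact_mod_cast h3
      exact hne (h2 e i hRe)
  rw [hL, hR']
  refine sum_congr ?_ fun _ _ => rfl
  ext e
  simp only [mem_filter, Fintype.mem_piFinset]
  tauto

/-- **Re-indexing the main coefficient sum by square-free tuples**: for `R > 1`, `Q > R`, `χ = 0` on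
`|x| ≥ 1` and any coefficients `a(e)`,
`∑_{e ∈ [1,R]^t} (∏_i μ(e_i)χ(log e_i/log R)) a(e) = ∑_{e ∈ SF(primes<Q)^t} (∏_i μ(e_i)χ(log e_i/log R)) a(e)`
(non-square-free entries are killed by `μ`, entries `≥ R` by `χ`). [cite: GreenTao2010, App. D, proof of Thm. D.3
("we may use Fourier expansion of `μ` …", the support of `χ`)] -/
theorem sum_box_eq_sum_squarefree {χ : ℝ → ℝ} (hsupp : ∀ x, 1 ≤ |x| → χ x = 0) {R : ℝ} (hR : 1 < R)
    {Q : ℕ} (hQ : R < Q) (a : (Fin t → ℕ) → ℝ) :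
    ∑ e ∈ Fintype.piFinset (fun _ : Fin t => Icc 1 ⌊R⌋₊), (∏ i, moebiusWeight χ R (e i)) * a e =
      ∑ e ∈ Fintype.piFinset (fun _ : Fin t => squarefreeOf Q.primesBelow),
        (∏ i, moebiusWeight χ R (e i)) * a e :=
  sum_box_eq_sum_squarefree_of hR hQ _
    (fun e i hi => by rw [prod_eq_zero (mem_univ i) (moebiusWeight_eq_zero_of_not_squarefree χ R hi), zero_mul])
    (fun e i hi => by rw [prod_eq_zero (mem_univ i) (moebiusWeight_eq_zero_of_le hsupp hR hi), zero_mul])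

/-! ### The error sum -/

/-- **The volume-packing errors summed over `[1,R]^t`**:
`∑_{e ∈ [1,R]^t} |∏_i μ(e_i)χ(·)| C E (N + 2E)^{d-1} ≤ C B^t R^{2t} (N + 2R^t)^{d-1}` (`E = ∏ e_i ≤ R^t`,
`|χ| ≤ B`; the paper: "`O(N^{d-1+O(γ)} log^{O(1)} R)`"). [cite: GreenTao2010, App. D, proof of Thm. D.3] -/
theorem sum_box_error_le {χ : ℝ → ℝ} {B : ℝ} (hB : ∀ x, |χ x| ≤ B) {R : ℝ} (hR : 1 ≤ R) {C : ℝ} (hC : 0 ≤ C)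
    (N : ℕ) :
    ∑ e ∈ Fintype.piFinset (fun _ : Fin t => Icc 1 ⌊R⌋₊),
        |∏ i, moebiusWeight χ R (e i)| * (C * (∏ i, (e i : ℝ)) * ((N : ℝ) + 2 * ∏ i, (e i : ℝ)) ^ (d - 1)) ≤
      C * B ^ t * R ^ t * (R ^ t * ((N : ℝ) + 2 * R ^ t) ^ (d - 1)) := by
  have hB0 : 0 ≤ B := (abs_nonneg _).trans (hB 0)
  have hterm : ∀ e ∈ Fintype.piFinset (fun _ : Fin t => Icc 1 ⌊R⌋₊),
      |∏ i, moebiusWeight χ R (e i)| * (C * (∏ i, (e i : ℝ)) * ((N : ℝ) + 2 * ∏ i, (e i : ℝ)) ^ (d - 1)) ≤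
        B ^ t * (C * R ^ t * ((N : ℝ) + 2 * R ^ t) ^ (d - 1)) := by
    intro e he
    have hei : ∀ i, (1 : ℝ) ≤ e i ∧ (e i : ℝ) ≤ R := fun i => by
      have h := Fintype.mem_piFinset.1 he i
      rw [mem_Icc] at h
      exact ⟨by exact_mod_cast h.1, le_trans (by exact_mod_cast h.2) (Nat.floor_le (by linarith))⟩
    have hE : (∏ i, (e i : ℝ)) ≤ R ^ t := by
      calc (∏ i, (e i : ℝ)) ≤ ∏ _i : Fin t, R := prod_le_prod (fun i _ => by linarith [(hei i).1]) fun i _ => (hei i).2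
        _ = R ^ t := by rw [prod_const, card_univ, Fintype.card_fin]
    have hE0 : 0 ≤ ∏ i, (e i : ℝ) := prod_nonneg fun i _ => by linarith [(hei i).1]
    have hw : |∏ i, moebiusWeight χ R (e i)| ≤ B ^ t := by
      rw [abs_prod]
      calc ∏ i, |moebiusWeight χ R (e i)| ≤ ∏ _i : Fin t, B :=
            prod_le_prod (fun i _ => abs_nonneg _) fun i _ => abs_moebiusWeight_le hB R (e i)
        _ = B ^ t := by rw [prod_const, card_univ, Fintype.card_fin]
    refine mul_le_mul hw ?_ (by positivity) (by positivity)
    have h2 : ((N : ℝ) + 2 * ∏ i, (e i : ℝ)) ^ (d - 1) ≤ ((N : ℝ) + 2 * R ^ t) ^ (d - 1) :=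
      pow_le_pow_left₀ (by positivity) (by linarith) _
    exact mul_le_mul (mul_le_mul_of_nonneg_left hE hC) h2 (by positivity) (by positivity)
  refine (sum_le_sum hterm).trans ?_
  rw [sum_const, Fintype.card_piFinset, prod_const, card_univ, Fintype.card_fin, Nat.card_Icc,
    Nat.add_sub_cancel, nsmul_eq_mul]
  have hfl : ((⌊R⌋₊ ^ t : ℕ) : ℝ) ≤ R ^ t := by
    push_cast
    exact pow_le_pow_left₀ (Nat.cast_nonneg _) (Nat.floor_le (by linarith)) t
  have hpos : 0 ≤ B ^ t * (C * R ^ t * ((N : ℝ) + 2 * R ^ t) ^ (d - 1)) := by positivity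
  calc ((⌊R⌋₊ ^ t : ℕ) : ℝ) * (B ^ t * (C * R ^ t * ((N : ℝ) + 2 * R ^ t) ^ (d - 1)))
      ≤ R ^ t * (B ^ t * (C * R ^ t * ((N : ℝ) + 2 * R ^ t) ^ (d - 1))) :=
        mul_le_mul_of_nonneg_right hfl hpos
    _ = C * B ^ t * R ^ t * (R ^ t * ((N : ℝ) + 2 * R ^ t) ^ (d - 1)) := by ring

/-! ### The main term, with constants uniform in the local data -/

section uniform

open MeasureTheory Complex

variable {ι : Type*} [Fintype ι]
variable {χ : ℝ → ℝ} (hs : ContDiff ℝ (⊤ : ℕ∞) χ) (hsupp : ∀ x, 1 ≤ |x| → χ x = 0)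
include hs hsupp

/-- **The main-term integral, evaluated, with constants depending on `χ` and `|ι|` only** (the
constants `K, C₀` of `exists_main_term_bound` do not depend on the local factors `α(p, B)`, i.e.
on `W` and the system; this uniformity in `w` and `b` is what (12.6) needs).
[cite: GreenTao2010, App. D, Thm. D.3 ((D.9)), Lemma D.2, (D.16)–(D.17), and p. 1834] -/
theorem exists_main_term_bound_uniform :
    ∃ K C₀ : ℝ, 0 ≤ K ∧ 1 ≤ C₀ ∧ ∀ {W : ℕ} (G : LocalCoeff ι W) (R : ℝ) (w : ℕ), Real.exp 1 ≤ R →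
      (∀ p : ℕ, p.Prime → (p ∣ W ↔ p ≤ w)) → 2 * Fintype.card ι ≤ w → 1 ≤ w →
      C₀ * (1 + Real.log (w + 1) + logSum w) ≤ Real.sqrt (Real.log R) →
        ‖(Real.log R : ℂ) ^ Fintype.card ι * ∫ η, (∏ i, phiF χ (η i)) * limitFn G R w η ∂(fullMeasure ι) -
            ((primorial w : ℂ) / Nat.totient (primorial w)) ^ Fintype.card ι *
              (-((deriv χ 0 : ℝ) : ℂ)) ^ Fintype.card ι‖ ≤
          ((primorial w : ℝ) / Nat.totient (primorial w)) ^ Fintype.card ι * K *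
            ((1 + logSum w) / Real.sqrt (Real.log R) + (Real.exp (4 * 2 ^ Fintype.card ι / w) - 1)) := by
  obtain ⟨K, C₀, hK0, hC₀1, hmain⟩ := exists_mainFactor_integral_bound hs hsupp
  obtain ⟨C₂, -, hC₂⟩ := exists_norm_inv_zeta_le
  set n : ℕ := Fintype.card ι with hn
  set c : ℂ := -((deriv χ 0 : ℝ) : ℂ) with hc
  set K' : ℝ := K + ‖c‖ + 1 with hK'
  have hK'1 : 1 ≤ K' := by rw [hK']; linarith [norm_nonneg c]
  refine ⟨(n + 1) * K' ^ (n + 1), C₀, by positivity, hC₀1, fun G R w hR hW hw hw1 hRw => ?_⟩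
  have hR1 : 1 < R := lt_of_lt_of_le (by have := Real.exp_one_gt_d9; linarith) hR
  obtain ⟨hdiff, habs⟩ := hmain R w hR hRw
  have hS0 := logSum_nonneg w
  have hsqrt0 : 0 < Real.sqrt (Real.log R) := Real.sqrt_pos.2 (Real.log_pos hR1)
  -- notation
  set Wφ : ℂ := (primorial w : ℂ) / Nat.totient (primorial w) with hWφ
  set Wφr : ℝ := (primorial w : ℝ) / Nat.totient (primorial w) with hWφr
  have hWφn : ‖Wφ‖ = Wφr := by rw [hWφ, norm_div, Complex.norm_natCast, Complex.norm_natCast]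
  have hWφr0 : 0 ≤ Wφr := by rw [hWφr]; positivity
  set F : (ι → ℝ) → ℂ := fun η => ∏ i, mainFactor R w (η i) with hF
  set Φ : (ι → ℝ) → ℂ := fun η => ∏ i, phiF χ (η i) with hΦ
  set Pc : (ι → ℝ) → ℂ := fun η => ∏' q, (1 + deltaSeq G R w η q) with hPc
  set πw : ℝ := Real.exp (4 * 2 ^ n / (w : ℝ)) - 1 with hπw
  have hπw0 : 0 ≤ πw := by rw [hπw]; linarith [Real.add_one_le_exp (4 * 2 ^ n / (w : ℝ)), (by positivity : (0:ℝ) ≤ 4 * 2 ^ n / (w : ℝ))]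
  have hPc1 : ∀ η, ‖Pc η - 1‖ ≤ πw := fun η =>
    (deltaSeq_summable_and_bounds G R w η hR1 hW hw hw1).2.2
  -- the pointwise identity `log^n R · L(η) = Wφ^n F(η) Π(η)`
  have hpt : ∀ η, (Real.log R : ℂ) ^ n * limitFn G R w η = Wφ ^ n * (F η * Pc η) := by
    intro η
    unfold limitFn
    rw [← mul_assoc, logpow_mul_main_eq R w η]
    simp only [hF, hPc, hWφ]
    ring
  -- integrability of `Φ F` and the value of its integral
  have hone : Integrable (fun x => phiF χ x * mainFactor R w x) := integrable_phiF_mul_mainFactor hs hsupp hC₂ hR w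
  have hΦF_eq : ∀ η, Φ η * F η = ∏ i, (phiF χ (η i) * mainFactor R w (η i)) := fun η => by
    simp only [hΦ, hF, prod_mul_distrib]
  have hΦFi : Integrable (fun η => Φ η * F η) (fullMeasure ι) := by
    simp_rw [hΦF_eq]
    unfold fullMeasure
    exact Integrable.fintype_prod (f := fun _ x => phiF χ x * mainFactor R w x) fun _ => hone
  have hΦF_int : ∫ η, Φ η * F η ∂(fullMeasure ι) = (∫ x, phiF χ x * mainFactor R w x) ^ n := by
    simp_rw [hΦF_eq]
    unfold fullMeasure
    rw [integral_fintype_prod_eq_prod (f := fun _ x => phiF χ x * mainFactor R w x), prod_const, card_univ]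
  have hΦF_abs : ∫ η, ‖Φ η * F η‖ ∂(fullMeasure ι) ≤ K ^ n := by
    have e : ∀ η, ‖Φ η * F η‖ = ∏ i, ‖phiF χ (η i) * mainFactor R w (η i)‖ := fun η => by
      rw [hΦF_eq, norm_prod]
    simp_rw [e]
    unfold fullMeasure
    rw [integral_fintype_prod_eq_prod (f := fun _ x => ‖phiF χ x * mainFactor R w x‖), prod_const, card_univ]
    exact pow_le_pow_left₀ (integral_nonneg fun x => norm_nonneg _) habs n
  -- measurability of `Φ · L` and integrability of `Φ F (Π - 1)`
  have hmeas := aestronglyMeasurable_prod_phiF_mul_limitFn G hs hsupp hR1 hW hw hw1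
  have hlogn : (Real.log R : ℂ) ^ n ≠ 0 := pow_ne_zero _ (by exact_mod_cast (Real.log_pos hR1).ne')
  have hWφ0 : Wφ ≠ 0 := by
    rw [hWφ]; exact div_ne_zero (by exact_mod_cast (primorial_pos w).ne')
      (by exact_mod_cast (Nat.totient_pos.2 (primorial_pos w)).ne')
  have hΦFP_eq : ∀ η, Φ η * (F η * Pc η) = ((Real.log R : ℂ) ^ n / Wφ ^ n) * (Φ η * limitFn G R w η) := by
    intro η
    have h2 : F η * Pc η = (Real.log R : ℂ) ^ n * limitFn G R w η / Wφ ^ n := by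
      rw [eq_div_iff (pow_ne_zero _ hWφ0), mul_comm]
      exact (hpt η).symm
    rw [h2]
    ring
  have hΦFP_meas : AEStronglyMeasurable (fun η => Φ η * (F η * Pc η)) (fullMeasure ι) := by
    simp_rw [hΦFP_eq]
    exact hmeas.const_mul _
  have hcorr_i : Integrable (fun η => Φ η * F η * (Pc η - 1)) (fullMeasure ι) := by
    have hm : AEStronglyMeasurable (fun η => Φ η * F η * (Pc η - 1)) (fullMeasure ι) := by
      have : (fun η => Φ η * F η * (Pc η - 1)) = fun η => Φ η * (F η * Pc η) - Φ η * F η := by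
        funext η; ring
      rw [this]
      exact hΦFP_meas.sub hΦFi.aestronglyMeasurable
    refine (hΦFi.norm.mul_const πw).mono' hm (ae_of_all _ fun η => ?_)
    rw [norm_mul]
    exact mul_le_mul_of_nonneg_left (hPc1 η) (norm_nonneg _)
  -- the decomposition of the integral
  have hint_eq : (Real.log R : ℂ) ^ n * ∫ η, Φ η * limitFn G R w η ∂(fullMeasure ι) =
      Wφ ^ n * ((∫ η, Φ η * F η ∂(fullMeasure ι)) + ∫ η, Φ η * F η * (Pc η - 1) ∂(fullMeasure ι)) := by
    rw [← integral_const_mul, ← integral_add hΦFi hcorr_i, ← integral_const_mul]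
    refine integral_congr_ae (ae_of_all _ fun η => ?_)
    show (Real.log R : ℂ) ^ n * (Φ η * limitFn G R w η) = Wφ ^ n * (Φ η * F η + Φ η * F η * (Pc η - 1))
    rw [mul_left_comm, hpt η]
    ring
  -- the two error terms
  have hI := hΦF_int
  set J : ℂ := ∫ x, phiF χ x * mainFactor R w x with hJ
  have hJK : ‖J‖ ≤ K := (norm_integral_le_integral_norm _).trans habs
  have hJK' : ‖J‖ ≤ K' := by rw [hK']; linarith [norm_nonneg c]
  have hcK' : ‖c‖ ≤ K' := by rw [hK']; linarith
  have hKK' : K ≤ K' := by rw [hK']; linarith [norm_nonneg c]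
  have hcJ : ‖J - c‖ ≤ K * (1 + logSum w) / Real.sqrt (Real.log R) := by
    rw [hJ, hc, ← integral_phiF_mul_aF hs hsupp]; exact hdiff
  have herr1 : ‖J ^ n - c ^ n‖ ≤ n * K' ^ (n - 1) * (K * (1 + logSum w) / Real.sqrt (Real.log R)) :=
    (norm_pow_sub_pow_le J c hJK' hcK' n).trans (mul_le_mul_of_nonneg_left hcJ (by positivity))
  have herr2 : ‖∫ η, Φ η * F η * (Pc η - 1) ∂(fullMeasure ι)‖ ≤ K ^ n * πw := by
    calc ‖∫ η, Φ η * F η * (Pc η - 1) ∂(fullMeasure ι)‖ ≤ ∫ η, ‖Φ η * F η‖ * πw ∂(fullMeasure ι) :=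
          norm_integral_le_of_norm_le (hΦFi.norm.mul_const πw) (ae_of_all _ fun η => by
            rw [norm_mul]; exact mul_le_mul_of_nonneg_left (hPc1 η) (norm_nonneg _))
      _ = (∫ η, ‖Φ η * F η‖ ∂(fullMeasure ι)) * πw := integral_mul_const _ _
      _ ≤ K ^ n * πw := mul_le_mul_of_nonneg_right hΦF_abs hπw0
  -- assemble
  rw [hint_eq, hI, show Wφ ^ n * (J ^ n + ∫ η, Φ η * F η * (Pc η - 1) ∂(fullMeasure ι)) - Wφ ^ n * c ^ n =
    Wφ ^ n * ((J ^ n - c ^ n) + ∫ η, Φ η * F η * (Pc η - 1) ∂(fullMeasure ι)) by ring, norm_mul, norm_pow, hWφn]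
  have hinner : ‖(J ^ n - c ^ n) + ∫ η, Φ η * F η * (Pc η - 1) ∂(fullMeasure ι)‖ ≤
      (n + 1) * K' ^ (n + 1) * ((1 + logSum w) / Real.sqrt (Real.log R) + πw) := by
    have h1 : (n : ℝ) * K' ^ (n - 1) * K ≤ (n + 1) * K' ^ (n + 1) := by
      have hp : K' ^ (n - 1) * K ≤ K' ^ (n + 1) := by
        calc K' ^ (n - 1) * K ≤ K' ^ (n - 1) * K' := mul_le_mul_of_nonneg_left hKK' (by positivity)
          _ = K' ^ (n - 1 + 1) := by rw [pow_succ]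
          _ ≤ K' ^ (n + 1) := pow_le_pow_right₀ hK'1 (by omega)
      calc (n : ℝ) * K' ^ (n - 1) * K = n * (K' ^ (n - 1) * K) := by ring
        _ ≤ (n + 1) * K' ^ (n + 1) := mul_le_mul (by linarith) hp (by positivity) (by positivity)
    have h2 : K ^ n ≤ (n + 1) * K' ^ (n + 1) := by
      calc K ^ n ≤ K' ^ n := pow_le_pow_left₀ hK0 hKK' n
        _ ≤ K' ^ (n + 1) := pow_le_pow_right₀ hK'1 (by omega)
        _ ≤ (n + 1) * K' ^ (n + 1) := le_mul_of_one_le_left (by positivity) (by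
            have : (0:ℝ) ≤ n := Nat.cast_nonneg n; linarith)
    have hq : 0 ≤ (1 + logSum w) / Real.sqrt (Real.log R) := by positivity
    calc ‖(J ^ n - c ^ n) + ∫ η, Φ η * F η * (Pc η - 1) ∂(fullMeasure ι)‖
        ≤ ‖J ^ n - c ^ n‖ + ‖∫ η, Φ η * F η * (Pc η - 1) ∂(fullMeasure ι)‖ := norm_add_le _ _
      _ ≤ n * K' ^ (n - 1) * (K * (1 + logSum w) / Real.sqrt (Real.log R)) + K ^ n * πw := add_le_add herr1 herr2
      _ = (n * K' ^ (n - 1) * K) * ((1 + logSum w) / Real.sqrt (Real.log R)) + K ^ n * πw := by ring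
      _ ≤ (n + 1) * K' ^ (n + 1) * ((1 + logSum w) / Real.sqrt (Real.log R)) + (n + 1) * K' ^ (n + 1) * πw :=
          add_le_add (mul_le_mul_of_nonneg_right h1 hq) (mul_le_mul_of_nonneg_right h2 hπw0)
      _ = (n + 1) * K' ^ (n + 1) * ((1 + logSum w) / Real.sqrt (Real.log R) + πw) := by ring
  calc Wφr ^ n * ‖(J ^ n - c ^ n) + ∫ η, Φ η * F η * (Pc η - 1) ∂(fullMeasure ι)‖
      ≤ Wφr ^ n * ((n + 1) * K' ^ (n + 1) * ((1 + logSum w) / Real.sqrt (Real.log R) + πw)) :=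
        mul_le_mul_of_nonneg_left hinner (pow_nonneg hWφr0 n)
    _ = Wφr ^ n * ((n + 1) * K' ^ (n + 1)) * ((1 + logSum w) / Real.sqrt (Real.log R) + πw) := by ring


end uniform

/-! ### The correlation estimate for `W`-tricked good systems (Thm. D.3 with `a_i = 1`) -/

section correlation

open MeasureTheory Complex Classical

variable {χ : ℝ → ℝ} (hs : ContDiff ℝ (⊤ : ℕ∞) χ) (hsupp : ∀ x, 1 ≤ |x| → χ x = 0)
include hs hsupp

/-- A smooth cutoff supported on `[-1,1]` is bounded. [folklore] -/
theorem exists_abs_cutoff_le : ∃ B : ℝ, 0 ≤ B ∧ ∀ x, |χ x| ≤ B := by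
  obtain ⟨B, hB⟩ := (isCompact_Icc (a := (-1 : ℝ)) (b := 1)).exists_bound_of_continuousOn
    hs.continuous.continuousOn
  refine ⟨max B 0, le_max_right _ _, fun x => ?_⟩
  by_cases hx : x ∈ Set.Icc (-1 : ℝ) 1
  · have := hB x hx
    rw [Real.norm_eq_abs] at this
    exact this.trans (le_max_left _ _)
  · rw [hsupp x ?_, abs_zero]
    · exact le_max_right _ _
    · rw [Set.mem_Icc, not_and_or, not_le, not_le] at hx
      rcases hx with hx | hx
      · rw [abs_of_neg (by linarith)]; linarith
      · rw [abs_of_pos (by linarith)]; linarith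

/-- **The Goldston–Yıldırım correlation estimate with `a_i = 1` for `W`-tricked good systems over
convex bodies** (Thm. D.3, (D.9), in the form needed for (12.6)): with constants `K, C, C₀`
depending only on `χ`, `t`, `d`, for `N ≥ 1`, a convex body `A ⊆ [-N,N]^d`, a good system `L`,
`W = W(w)` with `w ≥ max(2t, 1)`, `b` coprime to `W`, and `R ≥ e` with
`C₀(1 + log(w+1) + S₁(w)) ≤ log^{1/2} R`,
`|∑_{n ∈ A ∩ ℤ^d} ∏_i Λ_{χ,R,1}(W(L_i·n) + b) - vol(A) (W/φ(W))^t (-χ'(0))^t|`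
`≤ vol(A) (W/φ(W))^t K ((1 + S₁(w)) log^{-1/2} R + e^{4·2^t/w} - 1) + C log^t R · R^{2t} (N + 2R^t)^{d-1}`.
[cite: GreenTao2010, App. D, Thm. D.3 and p. 1834 ("The correlation estimate for `Λ♯`")] -/
theorem exists_wtrick_correlation_bound {d t : ℕ} (hd : 1 ≤ d) :
    ∃ K C C₀ : ℝ, 0 ≤ K ∧ 0 ≤ C ∧ 1 ≤ C₀ ∧
      ∀ (N : ℕ), 1 ≤ N → ∀ (A : Set (Fin d → ℝ)), Convex ℝ A → A ⊆ realBox d N →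
      ∀ (L : Fin t → Fin d → ℤ), GoodSystem L → ∀ (w : ℕ) (b : ℤ), IsCoprime b (primorial w) →
        2 * t ≤ w → 1 ≤ w →
      ∀ (R : ℝ), Real.exp 1 ≤ R → C₀ * (1 + Real.log (w + 1) + logSum w) ≤ Real.sqrt (Real.log R) →
        |(∑ n ∈ (latticeBox d N).filter (fun n => realPoint n ∈ A),
              ∏ i, truncDivisorSum χ R 1 ((wtrickSys (primorial w) L b i).eval n)) -
            (volume A).toReal * ((primorial w : ℝ) / Nat.totient (primorial w)) ^ t * (-(deriv χ 0)) ^ t| ≤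
          (volume A).toReal * ((primorial w : ℝ) / Nat.totient (primorial w)) ^ t * K *
              ((1 + logSum w) / Real.sqrt (Real.log R) + (Real.exp (4 * 2 ^ t / w) - 1)) +
            C * Real.log R ^ t * R ^ t * (R ^ t * ((N : ℝ) + 2 * R ^ t) ^ (d - 1)) := by
  obtain ⟨K, C₀, hK0, hC₀1, hmain⟩ := exists_main_term_bound_uniform (ι := Fin t) hs hsupp
  simp only [Fintype.card_fin] at hmain
  obtain ⟨Cv, hCv0, hvol⟩ := exists_sum_dvd_indicator_bound (t := t) hd
  obtain ⟨B, hB0, hB⟩ := exists_abs_cutoff_le hs hsupp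
  refine ⟨K, Cv * B ^ t, C₀, hK0, by positivity, hC₀1,
    fun N hN A hA hAN L hL w b hb hw hw1 R hR hRw => ?_⟩
  -- basic quantities
  have hR1 : 1 < R := lt_of_lt_of_le (by have := Real.exp_one_gt_d9; linarith) hR
  have hlogR : 0 < Real.log R := Real.log_pos hR1
  set W : ℕ := primorial w with hWdef
  have hWp : ∀ p : ℕ, p.Prime → (p ∣ W ↔ p ≤ w) := fun p hp => hp.dvd_primorial_iff
  set Ψ : Fin t → AffLinForm d := wtrickSys W L b with hΨ
  set G : LocalCoeff (Fin t) W := wtrickCoeff W L b hL hb with hG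
  set Q : ℕ := ⌊R⌋₊ + 2 with hQdef
  have hQ : R < Q := by
    have := Nat.lt_floor_add_one R
    rw [hQdef]; push_cast; linarith
  set Alat := (latticeBox d N).filter (fun n => realPoint n ∈ A) with hAlat
  set Box := Fintype.piFinset (fun _ : Fin t => Icc 1 ⌊R⌋₊) with hBox
  set wt : (Fin t → ℕ) → ℝ := fun e => ∏ i, moebiusWeight χ R (e i) with hwt
  set Se : (Fin t → ℕ) → ℝ := fun e => ∑ n ∈ Alat, ∏ i, if ((e i : ℕ) : ℤ) ∣ (Ψ i).eval n then (1 : ℝ) else 0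
    with hSe
  set αP : Finset ℕ → (Fin t → ℕ) → ℝ := fun P e => ∏ p ∈ P, primeDensity₀ Ψ (pattern e p) p with hαP
  set V : ℝ := (volume A).toReal with hV
  have hV0 : 0 ≤ V := ENNReal.toReal_nonneg
  set Wφr : ℝ := (W : ℝ) / Nat.totient W with hWφr
  have hWφr0 : 0 ≤ Wφr := by rw [hWφr]; positivity
  set errM : ℝ := (1 + logSum w) / Real.sqrt (Real.log R) + (Real.exp (4 * 2 ^ t / w) - 1) with herrM
  -- Step A: expansion
  have hA' : ∑ n ∈ Alat, ∏ i, truncDivisorSum χ R 1 ((Ψ i).eval n) =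
      Real.log R ^ t * ∑ e ∈ Box, wt e * Se e := sum_prod_truncDivisorSum_one_eq Alat Ψ χ R
  -- membership facts for `e ∈ Box`
  have hBox_le : ∀ e ∈ Box, ∀ i, 1 ≤ e i ∧ (e i : ℝ) ≤ R := fun e he i => by
    have h := Fintype.mem_piFinset.1 he i
    rw [mem_Icc] at h
    exact ⟨h.1, le_trans (by exact_mod_cast h.2) (Nat.floor_le (by linarith))⟩
  -- Step B: per-`e` volume packing error
  have herr_e : ∀ e ∈ Box, |wt e * Se e - wt e * (V * αP Q.primesBelow e)| ≤
      |wt e| * (Cv * (∏ i, (e i : ℝ)) * ((N : ℝ) + 2 * ∏ i, (e i : ℝ)) ^ (d - 1)) := by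
    intro e he
    by_cases hsq : ∀ i, Squarefree (e i)
    · have heSF : ∀ i, e i ∈ squarefreeOf Q.primesBelow := fun i =>
        mem_squarefreeOf_primesBelow (hsq i) (by
          have := (hBox_le e he i).2
          exact_mod_cast lt_of_le_of_lt this hQ)
      rw [← mul_sub, abs_mul]
      exact mul_le_mul_of_nonneg_left
        (hvol N hN A hA hAN Ψ (fun p hp => (Nat.mem_primesBelow.1 hp).2) e heSF) (abs_nonneg _)
    · push Not at hsq
      obtain ⟨i, hi⟩ := hsq
      have h0 : wt e = 0 := by
        simp only [hwt]
        exact prod_eq_zero (mem_univ i) (moebiusWeight_eq_zero_of_not_squarefree χ R hi)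
      rw [h0]; simp only [zero_mul, sub_zero, abs_zero]
      positivity
  -- Step C: the error sum
  have herr : |∑ e ∈ Box, (wt e * Se e - wt e * (V * αP Q.primesBelow e))| ≤
      Cv * B ^ t * R ^ t * (R ^ t * ((N : ℝ) + 2 * R ^ t) ^ (d - 1)) := by
    refine (abs_sum_le_sum_abs _ _).trans ((sum_le_sum herr_e).trans ?_)
    exact sum_box_error_le hB hR1.le hCv0 N
  -- Step D: the main sum, as the square-free tuple sum of the Euler-product file
  set MS : ℝ := ∑ e ∈ Box, wt e * αP Q.primesBelow e with hMS
  have hE1sum : ∀ Q' : ℕ, Q ≤ Q' →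
      ∑ dd ∈ Fintype.piFinset (fun _ : Fin t => squarefreeOf Q'.primesBelow),
        (∏ p ∈ Q'.primesBelow, (G.g p (pattern dd p) : ℂ)) *
          ((∏ i, (ArithmeticFunction.moebius (dd i) : ℂ)) *
            ∏ i, ((χ (Real.log (dd i) / Real.log R) : ℝ) : ℂ)) = (MS : ℂ) := by
    intro Q' hQ'
    have hQ'R : R < Q' := lt_of_lt_of_le hQ (by exact_mod_cast hQ')
    -- back to the box
    rw [← sum_box_eq_sum_squarefree_of hR1 hQ'R
      (fun dd => (∏ p ∈ Q'.primesBelow, (G.g p (pattern dd p) : ℂ)) *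
        ((∏ i, (ArithmeticFunction.moebius (dd i) : ℂ)) * ∏ i, ((χ (Real.log (dd i) / Real.log R) : ℝ) : ℂ)))
      (fun dd i hi => by
        rw [prod_eq_zero (mem_univ i) (by
          rw [ArithmeticFunction.moebius_eq_zero_of_not_squarefree hi]; simp), zero_mul, mul_zero])
      (fun dd i hi => by
        have h0 : χ (Real.log (dd i) / Real.log R) = 0 := by
          have := moebiusWeight_eq_zero_of_le hsupp hR1 hi
          unfold moebiusWeight at this
          rcases mul_eq_zero.1 this with h | h
          · -- `μ = 0`: then also fine, but we need `χ = 0`; use the support directly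
            refine hsupp _ ?_
            rw [abs_of_nonneg (div_nonneg (Real.log_nonneg (by linarith)) hlogR.le), le_div_iff₀ hlogR, one_mul]
            exact Real.log_le_log (by linarith) hi
          · exact h
        rw [mul_comm (∏ i, (ArithmeticFunction.moebius (dd i) : ℂ)), prod_eq_zero (mem_univ i) (by rw [h0]; simp),
          zero_mul, mul_zero])]
    rw [hMS]
    push_cast
    refine sum_congr rfl fun e he => ?_
    -- the local factors: `g p = primeDensity₀` at primes, and primes `≥ Q` contribute `1`
    have hg : ∀ p ∈ Q'.primesBelow, (G.g p (pattern e p) : ℂ) = ((primeDensity₀ Ψ (pattern e p) p : ℝ) : ℂ) := by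
      intro p hp
      have hpp := (Nat.mem_primesBelow.1 hp).2
      simp only [hG, wtrickCoeff, if_pos hpp, hΨ]
    rw [prod_congr rfl hg]
    have hsub : Q.primesBelow ⊆ Q'.primesBelow := fun p hp => by
      rw [Nat.mem_primesBelow] at hp ⊢; exact ⟨lt_of_lt_of_le hp.1 hQ', hp.2⟩
    have hprodP : ∏ p ∈ Q'.primesBelow, ((primeDensity₀ Ψ (pattern e p) p : ℝ) : ℂ) =
        ∏ p ∈ Q.primesBelow, ((primeDensity₀ Ψ (pattern e p) p : ℝ) : ℂ) := by
      rw [← prod_subset hsub]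
      intro p hp' hp
      have hpat : pattern e p = ∅ := by
        ext i
        simp only [notMem_empty, iff_false]
        intro hi
        have hpe : p ∣ e i := by simpa [pattern] using hi
        have hpQ : Q ≤ p := by
          by_contra hlt; push Not at hlt
          exact hp (Nat.mem_primesBelow.2 ⟨hlt, (Nat.mem_primesBelow.1 hp').2⟩)
        have hei := hBox_le e he i
        have : (e i : ℝ) < p := lt_of_le_of_lt hei.2 (lt_of_lt_of_le hQ (by exact_mod_cast hpQ))
        have hle := Nat.le_of_dvd hei.1 hpe
        exact absurd hle (by exact_mod_cast not_le.2 this)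
      rw [hpat, primeDensity₀_empty]; simp
    rw [hprodP]
    simp only [hwt, hαP, moebiusWeight]
    push_cast
    rw [prod_mul_distrib]
    ring
  -- Step E: the Euler-product file and the main-term file
  have hw' : 2 * Fintype.card (Fin t) ≤ w := by rwa [Fintype.card_fin]
  have hE1 := sum_coef_prod_chi_eq_integral_limit G hs hsupp hR hWp hw' hw1 (Q₀ := Q)
    (fun Q' hQ' => by rw [hE1sum Q' hQ', hE1sum Q le_rfl])
  rw [hE1sum Q le_rfl] at hE1
  have hM := hmain G R w hR hWp hw hw1 hRw
  have hint : ∫ η, (∏ i, phiF χ (η i)) * limitFn G R w η ∂(fullMeasure (Fin t)) = (MS : ℂ) := hE1.symm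
  rw [hint] at hM
  -- real parts
  have hmainR : |Real.log R ^ t * MS - Wφr ^ t * (-(deriv χ 0)) ^ t| ≤ Wφr ^ t * K * errM := by
    have e1 : ((Real.log R ^ t * MS - Wφr ^ t * (-(deriv χ 0)) ^ t : ℝ) : ℂ) =
        (Real.log R : ℂ) ^ t * (MS : ℂ) -
          ((primorial w : ℂ) / Nat.totient (primorial w)) ^ t * (-((deriv χ 0 : ℝ) : ℂ)) ^ t := by
      rw [hWφr, hWdef]; push_cast; ring
    have h2 : |Real.log R ^ t * MS - Wφr ^ t * (-(deriv χ 0)) ^ t| =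
        |((Real.log R : ℂ) ^ t * (MS : ℂ) -
          ((primorial w : ℂ) / Nat.totient (primorial w)) ^ t * (-((deriv χ 0 : ℝ) : ℂ)) ^ t).re| := by
      rw [← e1, Complex.ofReal_re]
    rw [h2]
    refine (Complex.abs_re_le_norm _).trans (hM.trans (le_of_eq ?_))
    rw [hWφr, hWdef]
  -- Step F: assemble
  have hsplit : ∑ e ∈ Box, wt e * Se e =
      V * MS + ∑ e ∈ Box, (wt e * Se e - wt e * (V * αP Q.primesBelow e)) := by
    rw [hMS, mul_sum, ← sum_add_distrib]
    exact sum_congr rfl fun e _ => by ring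
  have hlog0 : 0 ≤ Real.log R ^ t := pow_nonneg hlogR.le t
  rw [hA', hsplit]
  have eq : Real.log R ^ t * (V * MS + ∑ e ∈ Box, (wt e * Se e - wt e * (V * αP Q.primesBelow e))) -
      V * Wφr ^ t * (-(deriv χ 0)) ^ t =
      V * (Real.log R ^ t * MS - Wφr ^ t * (-(deriv χ 0)) ^ t) +
        Real.log R ^ t * ∑ e ∈ Box, (wt e * Se e - wt e * (V * αP Q.primesBelow e)) := by ring
  rw [eq]
  calc |V * (Real.log R ^ t * MS - Wφr ^ t * (-(deriv χ 0)) ^ t) +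
        Real.log R ^ t * ∑ e ∈ Box, (wt e * Se e - wt e * (V * αP Q.primesBelow e))|
      ≤ |V * (Real.log R ^ t * MS - Wφr ^ t * (-(deriv χ 0)) ^ t)| +
        |Real.log R ^ t * ∑ e ∈ Box, (wt e * Se e - wt e * (V * αP Q.primesBelow e))| := abs_add_le _ _
    _ = V * |Real.log R ^ t * MS - Wφr ^ t * (-(deriv χ 0)) ^ t| +
        Real.log R ^ t * |∑ e ∈ Box, (wt e * Se e - wt e * (V * αP Q.primesBelow e))| := by
        rw [abs_mul, abs_mul, abs_of_nonneg hV0, abs_of_nonneg hlog0]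
    _ ≤ V * (Wφr ^ t * K * errM) + Real.log R ^ t * (Cv * B ^ t * R ^ t * (R ^ t * ((N : ℝ) + 2 * R ^ t) ^ (d - 1))) :=
        add_le_add (mul_le_mul_of_nonneg_left hmainR hV0) (mul_le_mul_of_nonneg_left herr hlog0)
    _ = V * Wφr ^ t * K * errM + Cv * B ^ t * Real.log R ^ t * R ^ t * (R ^ t * ((N : ℝ) + 2 * R ^ t) ^ (d - 1)) := by
        ring

end correlation

end Literature.NumberTheory.Sieve.SharpGY
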